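import Literature.Computability.Cryptography.HILLGreedySamplers
import HarnessLib

/-!
# HILL Lemma 6.3.2: the adversary `M^{(A)}` as a probabilistic polynomial-time machine

Håstad–Impagliazzo–Levin–Luby, *A pseudorandom generator from any one-way function* (SIAM J. Comput.
28 (1999); preprint §6.3, Lemma 6.3.2, proof).  This file turns the two phases of the oracle adversary
`M^{(A)}` of Lemma 6.3.2 into one randomized algorithm `HILL.GH.Params.mach` in the TM2/`RandAlg` model and
proves (i) it is PPT for a PPT `A` (`isPPT_mach`), (ii) on a genuine input `⟨1^N, z⟩` with the prescribed
coin budget its output bit is the printed rule (`mach_run_eq`):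

* **Phase 1** (`stgF`, `ph1F`): `j` stages; stage `i` draws the Bernoulli bit `c` (`Pr[c = 1] = t/2^{b(N)}`),
  `τ(N)` candidates `w_m` with estimation coins, estimates `Δ(w_m) = (#accepting 𝒟-runs − #accepting
  ℰ-runs)/Ns` of `A` on `Ns(N)` sample pairs of `𝒟^{(τ·(w_m,c))}`, `ℰ^{(τ·(w_m,c))}` (`cntDF`, `cntEF`, the
  samplers and runs of `HILLGreedySamplers`), and keeps the first maximiser (`selF`); this is exactly the
  abstract stage `HILL.Greedy.Data.stage` of `HILLGreedySelection` for the data `QM` (`stgF_apply`,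
  `templateOf_eq_tmplM`).
* **Phase 2** (`outF`): plant the input atom `z` at position `j + 1`, run `A` on a `𝒟`-sample and on an
  `ℰ`-sample, output `β` if the answers agree and `A(D)` otherwise
  [HILL, Lemma 6.3.2 (proof, Phase 2: "If A(D) = A(E) then output β else output A(D)")].
* The advice — HILL's mild non-uniformity `t = t*(N)` (the density `p̃ = t/2^b` of `𝒯̃`), the phase-2 index
  `j = j*(N)` (HILL samples `j` uniformly; a maximising `j*` is at least as good, `HILLGreedySelection`'s
  `exists_good_stage`), and `A`'s own coin count `κ` — is carried by the coin budget
  `Code = ((κ+1)(k+1) + j)·Kb(N) + t` and decoded with two unary divisions (`Code_mod`, `Code_div_mod`,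
  `Code_div_div`), as in `MildlyNonuniformPRG`.

No new named facts; kernel-checked values of every program on well-formed records.
-/

namespace Literature.Computability.Cryptography

open Finset _root_.Computability Complexity HCProd Polynomial

namespace HILL

namespace Greedy.Data

variable {N : ℕ} (Q : Data N)

/-- `argmaxFirst` only depends on the strict comparisons of the values. [folklore] -/
theorem argmaxFirst_congr_lt {v v' : ℕ → ℝ} (h : ∀ a b, v a < v b ↔ v' a < v' b) : ∀ n, argmaxFirst v n = argmaxFirst v' n
  | 0 => rfl
  | n + 1 => by simp only [argmaxFirst, argmaxFirst_congr_lt h n, h]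

/-- `argmaxFirst v n` only reads `v` below `n`. [folklore] -/
theorem argmaxFirst_congr {v v' : ℕ → ℝ} : ∀ {n : ℕ}, (∀ m < n, v m = v' m) → argmaxFirst v n = argmaxFirst v' n
  | 0, _ => rfl
  | n + 1, h => by
    have ih := argmaxFirst_congr (n := n) fun m hm => h m (hm.trans n.lt_succ_self)
    rw [argmaxFirst, argmaxFirst, ih, h n n.lt_succ_self]
    rcases Nat.eq_zero_or_pos n with rfl | hn
    · simp [argmaxFirst, h 0 Nat.one_pos]
    · rw [h _ ((argmaxFirst_lt v' hn).trans n.lt_succ_self)]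

/-- The `m`-th block sits inside the first `cS` coins (`m < τn`). [folklore] -/
theorem blockOf_take (coins : List Bool) {m : ℕ} (hm : m < Q.τn) : Q.blockOf (coins.take Q.cS) m = Q.blockOf coins m := by
  unfold blockOf cS
  rw [List.drop_drop, List.drop_drop, List.drop_take, List.take_take, min_eq_left]
  have : (m + 1) * (N + Q.cE) ≤ Q.τn * (N + Q.cE) := Nat.mul_le_mul_right _ hm
  rw [Nat.succ_mul] at this
  omega

/-- **A stage only reads the first `cS` coins.** [folklore] -/
theorem stage_take (hτ : 1 ≤ Q.τn) (τ : List (List Bool × Bool)) (coins : List Bool) :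
    Q.stage τ (coins.take Q.cS) = Q.stage τ coins := by
  have hc : Q.cOf (coins.take Q.cS) = Q.cOf coins := by
    unfold cOf cS; rw [List.take_take, min_eq_left (Nat.le_add_right _ _)]
  have hv : ∀ m < Q.τn, Q.estv τ (coins.take Q.cS) m = Q.estv τ coins m := fun m hm => by
    unfold estv cand ceOf; rw [Q.blockOf_take coins hm, hc]
  unfold stage choice
  rw [argmaxFirst_congr hv, hc]
  unfold cand
  rw [Q.blockOf_take coins (argmaxFirst_lt _ hτ)]

/-- Templates built stagewise from the suffixes of one coin string only depend on the stage windows. [folklore] -/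
theorem templateOf_take (hτ : 1 ≤ Q.τn) : ∀ (j : ℕ) (cc : List Bool), Q.templateOf j (cc.take (j * Q.cS)) = Q.templateOf j cc
  | 0, _ => rfl
  | j + 1, cc => by
    rw [templateOf, templateOf, List.take_take, min_eq_left (Nat.mul_le_mul_right _ j.le_succ), List.drop_take,
      show (j + 1) * Q.cS - j * Q.cS = Q.cS by rw [Nat.succ_mul]; omega, Q.stage_take hτ]

end Greedy.Data

namespace GH

namespace Params

variable (P : Params) (f : List Bool → List Bool) (A : RandAlg (List Bool) Bool) (NsP τnP : Polynomial ℕ)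

/-! ### The machine's selection data and counts -/

/-- Estimation coins per candidate: `Ns` sample pairs. [folklore] -/
def cE (N t : ℕ) : ℕ := NsP.eval N * P.cSamp A N t

/-- **The selection data the machine realises** (the fields `Tt, δ, ρ, η` are analysis-only and set to
dummies here; `HILLGreedyHybrid` fills them). [cite: HastadImpagliazzoLevinLuby1999, Lemma 6.3.2 (proof, Phase 1)] -/
noncomputable def QM (N t : ℕ) : Greedy.Data N where
  Tt := ∅
  δ := fun _ => 0
  est := P.estim f A (NsP.eval N) N t
  b := bLen N
  t := t
  τn := τnP.eval N
  cE := P.cE A NsP N t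
  ρ := 0
  η := 0

/-- `#{s < Ns : A accepts the s-th 𝒟-sample}` read off the estimation coins `ce` (template already extended). [folklore] -/
noncomputable def cntD (N t : ℕ) (τ : List (List Bool × Bool)) (ce : List Bool) : ℕ :=
  ∑ s ∈ Finset.range (NsP.eval N), (P.runD f A N t τ false [] ((Greedy.blkL (P.cSamp A N t) s ce).take (P.dTot A N t))).toNat

/-- `#{s < Ns : A accepts the s-th ℰ-sample}`. [folklore] -/
noncomputable def cntE (N t : ℕ) (τ : List (List Bool × Bool)) (ce : List Bool) : ℕ :=
  ∑ s ∈ Finset.range (NsP.eval N), (P.runE f A N t τ false [] ((Greedy.blkL (P.cSamp A N t) s ce).drop (P.dTot A N t))).toNat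

/-- **The integer score** of candidate `m`: `cntD − cntE` on the template extended by `(w_m, c)`. [folklore] -/
noncomputable def score (N t : ℕ) (τ : List (List Bool × Bool)) (coins : List Bool) (m : ℕ) : ℤ :=
  (P.cntD f A NsP N t (τ ++ [((P.QM f A NsP τnP N t).cand coins m, (P.QM f A NsP τnP N t).cOf coins)])
      ((P.QM f A NsP τnP N t).ceOf coins m) : ℤ) -
    P.cntE f A NsP N t (τ ++ [((P.QM f A NsP τnP N t).cand coins m, (P.QM f A NsP τnP N t).cOf coins)])
      ((P.QM f A NsP τnP N t).ceOf coins m)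

/-- **The state of the selection fold** after `m` candidates: the counts and the candidate of the current
best, from the sentinel `(0, Ns + 1, ε)` that every candidate beats. [folklore] -/
noncomputable def selSt (N t : ℕ) (τ : List (List Bool × Bool)) (coins : List Bool) : ℕ → ℕ × ℕ × List Bool
  | 0 => (0, NsP.eval N + 1, [])
  | m + 1 =>
    let Q := P.QM f A NsP τnP N t
    let st := selSt N t τ coins m
    let dm := P.cntD f A NsP N t (τ ++ [(Q.cand coins m, Q.cOf coins)]) (Q.ceOf coins m)
    let em := P.cntE f A NsP N t (τ ++ [(Q.cand coins m, Q.cOf coins)]) (Q.ceOf coins m)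
    if st.1 + em < dm + st.2.1 then (dm, em, Q.cand coins m) else st

/-- **The machine's templates**: `T₀ = ε`, `T_{i+1} = stage T_i (R ⇂ i·cS)`. [cite: HastadImpagliazzoLevinLuby1999, Lemma 6.3.2 (proof, Phase 1)] -/
noncomputable def tmplM (N t : ℕ) (R : List Bool) : ℕ → List (List Bool × Bool)
  | 0 => []
  | i + 1 => (P.QM f A NsP τnP N t).stage (tmplM N t R i) (R.drop (i * (P.QM f A NsP τnP N t).cS))

/-- **The output rule of Phase 2** on the template `T_j`, the atom `z` and the coins after Phase 1:
`β` if `A(D) = A(E)`, else `A(D)`. [cite: HastadImpagliazzoLevinLuby1999, Lemma 6.3.2 (proof, Phase 2)] -/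
noncomputable def outM (N t j : ℕ) (z R : List Bool) : Bool :=
  let Q := P.QM f A NsP τnP N t
  let τ := P.tmplM f A NsP τnP N t R j
  let Rr := R.drop (j * Q.cS)
  let aD := P.runD f A N t τ true z (Rr.take (P.dTot A N t))
  let aE := P.runE f A N t τ true z ((Rr.drop (P.dTot A N t)).take (P.eTot A N t))
  let β := ((Rr.drop (P.dTot A N t + P.eTot A N t)).take 1 = [true])
  if aD = aE then decide β else aD

variable {P f A NsP τnP}

/-- `ind (b = true) = b.toNat`. [folklore] -/
theorem ind_eq_toNat (b : Bool) : Greedy.ind (b = true) = (b.toNat : ℝ) := by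
  cases b <;> simp [Greedy.ind_of_true, Greedy.ind_of_false]

/-- The counts are at most `Ns`. [folklore] -/
theorem cntD_le (N t : ℕ) (τ : List (List Bool × Bool)) (ce : List Bool) : P.cntD f A NsP N t τ ce ≤ NsP.eval N := by
  unfold cntD
  refine (Finset.sum_le_sum fun s _ => Bool.toNat_le _).trans ?_
  simp

/-- The counts are at most `Ns`. [folklore] -/
theorem cntE_le (N t : ℕ) (τ : List (List Bool × Bool)) (ce : List Bool) : P.cntE f A NsP N t τ ce ≤ NsP.eval N := by
  unfold cntE
  refine (Finset.sum_le_sum fun s _ => Bool.toNat_le _).trans ?_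
  simp

/-- **The estimate is the normalised count difference.** [cite: HastadImpagliazzoLevinLuby1999, Lemma 6.3.2 (proof: the estimate Δ)] -/
theorem estim_eq (N t : ℕ) (τ : List (List Bool × Bool)) (wc : List Bool × Bool) (ce : List Bool) :
    P.estim f A (NsP.eval N) N t τ wc ce = ((P.cntD f A NsP N t (τ ++ [wc]) ce : ℝ) - P.cntE f A NsP N t (τ ++ [wc]) ce) / NsP.eval N := by
  unfold estim cntD cntE
  rw [Finset.sum_sub_distrib]
  push_cast
  simp only [ind_eq_toNat]

/-- The abstract estimate of candidate `m` is `score m / Ns`. [folklore] -/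
theorem estv_eq (N t : ℕ) (τ : List (List Bool × Bool)) (coins : List Bool) (m : ℕ) :
    (P.QM f A NsP τnP N t).estv τ coins m = (P.score f A NsP τnP N t τ coins m : ℝ) / NsP.eval N := by
  unfold Greedy.Data.estv score
  rw [show (P.QM f A NsP τnP N t).est = P.estim f A (NsP.eval N) N t from rfl, estim_eq]
  push_cast
  rfl

/-- The first maximiser of the estimates is the first maximiser of the scores. [folklore] -/
theorem argmaxFirst_estv (N t : ℕ) (τ : List (List Bool × Bool)) (coins : List Bool) (n : ℕ) :
    Greedy.Data.argmaxFirst ((P.QM f A NsP τnP N t).estv τ coins) n =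
      Greedy.Data.argmaxFirst (fun m => (P.score f A NsP τnP N t τ coins m : ℝ)) n := by
  refine Greedy.Data.argmaxFirst_congr_lt (fun a b => ?_) n
  rw [estv_eq, estv_eq]
  rcases Nat.eq_zero_or_pos (NsP.eval N) with h0 | hpos
  · have hD : ∀ τ' ce, P.cntD f A NsP N t τ' ce = 0 := fun τ' ce => by unfold cntD; rw [h0, Finset.range_zero, Finset.sum_empty]
    have hE : ∀ τ' ce, P.cntE f A NsP N t τ' ce = 0 := fun τ' ce => by unfold cntE; rw [h0, Finset.range_zero, Finset.sum_empty]
    simp only [score, hD, hE, Nat.cast_zero, sub_self, Int.cast_zero, zero_div, lt_self_iff_false]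
  · have hc : (0 : ℝ) < NsP.eval N := by exact_mod_cast hpos
    rw [div_lt_div_iff_of_pos_right hc]

/-- **The fold keeps the first maximiser**: after `m + 1` candidates the state is that of
`argmaxFirst score (m + 1)`. [cite: HastadImpagliazzoLevinLuby1999, Lemma 6.3.2 (proof: "the index for which Δ(w_{m₀}) is maximized")] -/
theorem selSt_succ (N t : ℕ) (τ : List (List Bool × Bool)) (coins : List Bool) : ∀ m : ℕ,
    P.selSt f A NsP τnP N t τ coins (m + 1) =
      let Q := P.QM f A NsP τnP N t
      let a := Greedy.Data.argmaxFirst (fun m => (P.score f A NsP τnP N t τ coins m : ℝ)) (m + 1)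
      (P.cntD f A NsP N t (τ ++ [(Q.cand coins a, Q.cOf coins)]) (Q.ceOf coins a),
        P.cntE f A NsP N t (τ ++ [(Q.cand coins a, Q.cOf coins)]) (Q.ceOf coins a), Q.cand coins a)
  | 0 => by
    have hlt : 0 + P.cntE f A NsP N t (τ ++ [((P.QM f A NsP τnP N t).cand coins 0, (P.QM f A NsP τnP N t).cOf coins)])
        ((P.QM f A NsP τnP N t).ceOf coins 0) <
        P.cntD f A NsP N t (τ ++ [((P.QM f A NsP τnP N t).cand coins 0, (P.QM f A NsP τnP N t).cOf coins)])
          ((P.QM f A NsP τnP N t).ceOf coins 0) + (NsP.eval N + 1) := by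
      have := cntE_le (P := P) (f := f) (A := A) (NsP := NsP) N t
        (τ ++ [((P.QM f A NsP τnP N t).cand coins 0, (P.QM f A NsP τnP N t).cOf coins)]) ((P.QM f A NsP τnP N t).ceOf coins 0)
      omega
    simp only [selSt, if_pos hlt, Greedy.Data.argmaxFirst, lt_self_iff_false, if_false]
  | m + 1 => by
    have ih := selSt_succ N t τ coins m
    simp only at ih
    set Q := P.QM f A NsP τnP N t with hQ
    set v : ℕ → ℝ := fun m => (P.score f A NsP τnP N t τ coins m : ℝ) with hv
    set a := Greedy.Data.argmaxFirst v (m + 1) with ha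
    rw [selSt, ih]
    simp only
    have key : (P.cntD f A NsP N t (τ ++ [(Q.cand coins a, Q.cOf coins)]) (Q.ceOf coins a) +
          P.cntE f A NsP N t (τ ++ [(Q.cand coins (m + 1), Q.cOf coins)]) (Q.ceOf coins (m + 1)) <
        P.cntD f A NsP N t (τ ++ [(Q.cand coins (m + 1), Q.cOf coins)]) (Q.ceOf coins (m + 1)) +
          P.cntE f A NsP N t (τ ++ [(Q.cand coins a, Q.cOf coins)]) (Q.ceOf coins a)) ↔ v a < v (m + 1) := by
      simp only [hv, score, ← hQ, Int.cast_sub, Int.cast_natCast]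
      constructor
      · intro h; have h' : _ := (Nat.cast_lt (α := ℝ)).2 h; push_cast at h'; linarith
      · intro h
        have h' : ((P.cntD f A NsP N t (τ ++ [(Q.cand coins a, Q.cOf coins)]) (Q.ceOf coins a) +
            P.cntE f A NsP N t (τ ++ [(Q.cand coins (m + 1), Q.cOf coins)]) (Q.ceOf coins (m + 1)) : ℕ) : ℝ) <
            ((P.cntD f A NsP N t (τ ++ [(Q.cand coins (m + 1), Q.cOf coins)]) (Q.ceOf coins (m + 1)) +
              P.cntE f A NsP N t (τ ++ [(Q.cand coins a, Q.cOf coins)]) (Q.ceOf coins a) : ℕ) : ℝ) := by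
          push_cast; linarith
        exact_mod_cast h'
    by_cases hlt : v a < v (m + 1)
    · rw [if_pos (key.2 hlt), Greedy.Data.argmaxFirst, ← ha, if_pos hlt]
    · rw [if_neg (fun h => hlt (key.1 h)), Greedy.Data.argmaxFirst, ← ha, if_neg hlt]

/-- The machine's templates are the abstract ones (`1 ≤ τn`). [folklore] -/
theorem templateOf_eq_tmplM {N : ℕ} (hτ : 1 ≤ τnP.eval N) (t : ℕ) (R : List Bool) : ∀ j : ℕ,
    (P.QM f A NsP τnP N t).templateOf j R = P.tmplM f A NsP τnP N t R j
  | 0 => rfl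
  | j + 1 => by
    rw [Greedy.Data.templateOf, tmplM, ← templateOf_eq_tmplM hτ t R j,
      Greedy.Data.templateOf_take _ (show 1 ≤ (P.QM f A NsP τnP N t).τn from hτ)]

/-! ### Programs, I: the estimator -/

section Program

open Complexity.Brick Complexity.Plumb Complexity.OracleCompose

variable (P f A NsP τnP) (kcP : Polynomial ℕ) (mlenF : List Bool → List Bool)

/-- `|1ⁿ| = n`. [folklore] -/
private theorem length_unary' (n : ℕ) : (unaryEncodeNat n).length = n := unary_decode_encode_nat n

/-- **The header** `⟨⟨1^N, 1^t⟩, 1^κ⟩` and **the working record** `⟨hdr, ⟨tmpl, coins⟩⟩` (an estimation record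
when `coins` are estimation coins, a stage record when they are the remaining coins). [folklore] -/
def hdr (N t κ : ℕ) : List Bool := boolPair (boolPair (unaryEncodeNat N) (unaryEncodeNat t)) (ones κ)

/-- The working record. [folklore] -/
def wrec (N t κ : ℕ) (τ : List (List Bool × Bool)) (cs : List Bool) : List Bool := boolPair (hdr N t κ) (boolPair (encT τ) cs)

/-- `hdr`. [folklore] -/
noncomputable def eHdr : List Bool → List Bool := fstF
/-- `ctx = ⟨1^N, 1^t⟩`. [folklore] -/
noncomputable def eCtx : List Bool → List Bool := fstF ∘ fstF
/-- `1^κ`. [folklore] -/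
noncomputable def eK : List Bool → List Bool := sndF ∘ fstF
/-- the template. [folklore] -/
noncomputable def eTm : List Bool → List Bool := fstF ∘ sndF
/-- the coins. [folklore] -/
noncomputable def eCs : List Bool → List Bool := sndF ∘ sndF
/-- `1^N`. [folklore] -/
noncomputable def eN : List Bool → List Bool := fstF ∘ fstF ∘ fstF
/-- `1^t`. [folklore] -/
noncomputable def eT : List Bool → List Bool := sndF ∘ fstF ∘ fstF
/-- `Y = ⟨ctx, ⟨tmpl, ⟨[false], ε⟩⟩⟩` (the context record of a no-challenge run). [folklore] -/
noncomputable def eY : List Bool → List Bool := fanoutFn eCtx (fanoutFn eTm (fun _ => boolPair [false] []))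
/-- `⟨Y, ε⟩` (to read the units of `HILLGreedySamplers`). [folklore] -/
noncomputable def eQ : List Bool → List Bool := fanoutFn eY (fun _ => [])
/-- `1^{k·cP}`. [folklore] -/
noncomputable def ekk : List Bool → List Bool := kkcPU kcP ∘ eQ
/-- `1^{uLen}`. [folklore] -/
noncomputable def euL : List Bool → List Bool := uLU kcP mlenF ∘ eQ
/-- `1^{mlen}`. [folklore] -/
noncomputable def eml : List Bool → List Bool := mlU mlenF ∘ eQ
/-- `1^{dTot}`. [folklore] -/
noncomputable def edT : List Bool → List Bool := concatFn ∘ fanoutFn (concatFn ∘ fanoutFn (ekk kcP) (euL kcP mlenF)) eK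
/-- `1^{eTot}`. [folklore] -/
noncomputable def eeT : List Bool → List Bool :=
  concatFn ∘ fanoutFn (concatFn ∘ fanoutFn (concatFn ∘ fanoutFn (ekk kcP) (euL kcP mlenF)) (eml mlenF)) eK
/-- `1^{cSamp}`. [folklore] -/
noncomputable def ecS : List Bool → List Bool := concatFn ∘ fanoutFn (edT kcP mlenF) (eeT kcP mlenF)
/-- `1^{Ns}`. [folklore] -/
noncomputable def eNs : List Bool → List Bool := polyFn NsP ∘ eN
/-- On `⟨x, 1^s⟩`: the `s`-th sample block of the coins. [folklore] -/
noncomputable def zBlk : List Bool → List Bool :=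
  takeFn ∘ fanoutFn (ecS kcP mlenF ∘ fstF) (dropFn ∘ fanoutFn (HashBricks.umulFn ∘ fanoutFn sndF (ecS kcP mlenF ∘ fstF)) (eCs ∘ fstF))
/-- `[A(𝒟-sample of block s)]`. [folklore] -/
noncomputable def zD : List Bool → List Bool :=
  runDF f kcP mlenF A ∘ fanoutFn (eY ∘ fstF) (takeFn ∘ fanoutFn (edT kcP mlenF ∘ fstF) (zBlk kcP mlenF))
/-- `[A(ℰ-sample of block s)]`. [folklore] -/
noncomputable def zE : List Bool → List Bool :=
  runEF f kcP mlenF A ∘ fanoutFn (eY ∘ fstF) (dropFn ∘ fanoutFn (edT kcP mlenF ∘ fstF) (zBlk kcP mlenF))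
/-- The unary indicator of a one-bit string: `[b] ↦ 1^{b}`. [folklore] -/
noncomputable def unaryBit (c : List Bool → List Bool) : List Bool → List Bool := iteFn c (fun _ => [true]) (fun _ => [])
/-- Fold initial state `⟨x, ⟨bin Ns, ⟨ε, ε⟩⟩⟩`. [folklore] -/
noncomputable def eInit : List Bool → List Bool := fanoutFn (fun w => w) (fanoutFn (lenBinF ∘ eNs NsP) (fun _ => boolPair [] []))
/-- **`1^{cntD}`**: the counting fold over the `Ns` sample blocks. [cite: HastadImpagliazzoLevinLuby1999, Lemma 6.3.2 (proof: "sampling O(n/ρ²) times")] -/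
noncomputable def cntDF : List Bool → List Bool := sndPow 2 ∘ foldLoop appF (clipF 1 (unaryBit (zD f A kcP mlenF))) NsP ∘ eInit NsP
/-- **`1^{cntE}`.** [cite: HastadImpagliazzoLevinLuby1999, Lemma 6.3.2 (proof: "sampling O(n/ρ²) times")] -/
noncomputable def cntEF : List Bool → List Bool := sndPow 2 ∘ foldLoop appF (clipF 1 (unaryBit (zE f A kcP mlenF))) NsP ∘ eInit NsP

variable {P f A NsP τnP kcP mlenF}

/-- `unaryEncodeNat n = 1ⁿ`. [folklore] -/
private theorem unary_eq_ones (n : ℕ) : unaryEncodeNat n = ones n := Complexity.unaryEncodeNat_eq_replicate n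

/-- A concatenation of blocks of ones. [folklore] -/
private theorem flatten_ones (g : ℕ → ℕ) : ∀ n : ℕ, ((List.range n).map fun j => ones (g j)).flatten = ones (∑ j ∈ Finset.range n, g j)
  | 0 => by simp [ones]
  | n + 1 => by
    rw [List.range_succ, List.map_append, List.flatten_append, flatten_ones g n, Finset.sum_range_succ, List.map_singleton,
      List.flatten_singleton, Com.ones_append]

/-- Value of `unaryBit`. [folklore] -/
theorem unaryBit_apply {c : List Bool → List Bool} {z : List Bool} {b : Bool} (h : c z = [b]) : unaryBit c z = ones b.toNat := by
  rw [unaryBit, iteFn_apply h]; cases b <;> rfl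

/-- `unaryBit c ∈ FP`. [folklore] -/
theorem unaryBit_mem_FP {c : List Bool → List Bool} (hc : c ∈ FP) : unaryBit c ∈ FP := iteFn_mem_FP hc (const_mem_FP _) (const_mem_FP _)

/-- **Values of the accessors and units on a working record** (`κ = κ_A`). [folklore] -/
theorem eunits (hS : ProgSpec P kcP mlenF) (N t : ℕ) (τ : List (List Bool × Bool)) (cs : List Bool) :
    let x := wrec N t (P.κA A N t) τ cs
    eHdr x = hdr N t (P.κA A N t) ∧ eCtx x = boolPair (unaryEncodeNat N) (unaryEncodeNat t) ∧ eK x = ones (P.κA A N t) ∧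
      eTm x = encT τ ∧ eCs x = cs ∧ eN x = unaryEncodeNat N ∧ eT x = unaryEncodeNat t ∧ eY x = yrec N t τ false [] ∧
      edT kcP mlenF x = ones (P.dTot A N t) ∧ eeT kcP mlenF x = ones (P.eTot A N t) ∧ ecS kcP mlenF x = ones (P.cSamp A N t) ∧
      eNs NsP x = ones (NsP.eval N) := by
  intro x
  have h1 : eHdr x = hdr N t (P.κA A N t) := by simp [x, eHdr, wrec]
  have h2 : eCtx x = boolPair (unaryEncodeNat N) (unaryEncodeNat t) := by simp [x, eCtx, wrec, hdr]
  have h3 : eK x = ones (P.κA A N t) := by simp [x, eK, wrec, hdr]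
  have h4 : eTm x = encT τ := by simp [x, eTm, wrec]
  have h5 : eCs x = cs := by simp [x, eCs, wrec]
  have h6 : eN x = unaryEncodeNat N := by simp [x, eN, wrec, hdr]
  have h7 : eT x = unaryEncodeNat t := by simp [x, eT, wrec, hdr]
  have h8 : eY x = yrec N t τ false [] := by rw [eY, fanoutFn_apply, fanoutFn_apply, h2, h4, yrec]
  have hQ : eQ x = boolPair (yrec N t τ false []) [] := by rw [eQ, fanoutFn_apply, h8]
  obtain ⟨-, hkk, hml, huL, -⟩ := unitsR (P := P) hS N t τ false [] []
  have h9 : ekk kcP x = ones (P.kk N * cP N) := by rw [ekk, Function.comp_apply, hQ, hkk]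
  have h10 : euL kcP mlenF x = ones (P.uLen N t) := by rw [euL, Function.comp_apply, hQ, huL]
  have h11 : eml mlenF x = ones (P.mlen N t) := by rw [eml, Function.comp_apply, hQ, hml]
  have h12 : edT kcP mlenF x = ones (P.dTot A N t) := by
    rw [edT, Function.comp_apply, fanoutFn_apply, Function.comp_apply, fanoutFn_apply, h9, h10, h3, concatFn_boolPair, concatFn_boolPair,
      Com.ones_append, Com.ones_append, dTot]
  have h13 : eeT kcP mlenF x = ones (P.eTot A N t) := by
    rw [eeT, Function.comp_apply, fanoutFn_apply, Function.comp_apply, fanoutFn_apply, Function.comp_apply, fanoutFn_apply, h9, h10, h11,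
      h3, concatFn_boolPair, concatFn_boolPair, concatFn_boolPair, Com.ones_append, Com.ones_append, Com.ones_append, eTot]
  have h14 : ecS kcP mlenF x = ones (P.cSamp A N t) := by
    rw [ecS, Function.comp_apply, fanoutFn_apply, h12, h13, concatFn_boolPair, Com.ones_append, cSamp]
  have h15 : eNs NsP x = ones (NsP.eval N) := by rw [eNs, Function.comp_apply, h6, polyFn_apply, length_unary']
  exact ⟨h1, h2, h3, h4, h5, h6, h7, h8, h12, h13, h14, h15⟩

/-- The sample blocks have full length. [folklore] -/
theorem length_blkL_cE {N t s : ℕ} {cs : List Bool} (hcs : cs.length = P.cE A NsP N t) (hs : s < NsP.eval N) :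
    (Greedy.blkL (P.cSamp A N t) s cs).length = P.cSamp A N t :=
  length_blkL (by rw [hcs, cE]) hs

/-- `dTot ≤ cSamp` and `kk·cP ≤ dTot`. [folklore] -/
theorem dTot_le_cSamp (N t : ℕ) : P.dTot A N t ≤ P.cSamp A N t ∧ P.kk N * cP N ≤ P.dTot A N t ∧
    P.kk N * cP N ≤ P.cSamp A N t - P.dTot A N t := by
  refine ⟨Nat.le_add_right _ _, ?_, ?_⟩
  · unfold dTot; omega
  · unfold cSamp eTot; omega

/-- **Values of the run pieces** on `⟨x, 1^s⟩`, `s < Ns`. [folklore] -/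
theorem pieces_apply (hS : ProgSpec P kcP mlenF) (hlp : IsLengthPreserving f) {N t : ℕ} (hk : 1 ≤ P.kc N)
    {τ : List (List Bool × Bool)} (hτ : ∀ q ∈ τ, q.1.length = N) {cs : List Bool} (hcs : cs.length = P.cE A NsP N t)
    {s : ℕ} (hs : s < NsP.eval N) :
    let z := boolPair (wrec N t (P.κA A N t) τ cs) (ones s)
    zD f A kcP mlenF z = encodeBool (P.runD f A N t τ false [] ((Greedy.blkL (P.cSamp A N t) s cs).take (P.dTot A N t))) ∧
      zE f A kcP mlenF z = encodeBool (P.runE f A N t τ false [] ((Greedy.blkL (P.cSamp A N t) s cs).drop (P.dTot A N t))) := by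
  intro z
  obtain ⟨-, -, -, -, h5, -, -, h8, h12, -, h14, -⟩ := eunits (A := A) (NsP := NsP) hS N t τ cs
  have hblkL := length_blkL_cE hcs hs
  obtain ⟨hdc, hkd, hkc⟩ := dTot_le_cSamp (P := P) (A := A) N t
  have hblk : zBlk kcP mlenF z = Greedy.blkL (P.cSamp A N t) s cs := by
    rw [zBlk, Function.comp_apply, fanoutFn_apply, Function.comp_apply, fstF_boolPair, h14, Function.comp_apply, fanoutFn_apply,
      Function.comp_apply, fanoutFn_apply, sndF_boolPair, Function.comp_apply, fstF_boolPair, h14, HashBricks.umulFn_apply, fstF_boolPair,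
      sndF_boolPair, Function.comp_apply, fstF_boolPair, h5, dropFn_boolPair, takeFn_boolPair, Greedy.blkL]
    simp [ones]
  have hz : (false = true → ([] : List Bool).length = La N) := fun h => absurd h Bool.false_ne_true
  constructor
  · rw [zD, Function.comp_apply, fanoutFn_apply, Function.comp_apply, fstF_boolPair, h8, Function.comp_apply, fanoutFn_apply,
      Function.comp_apply, fstF_boolPair, h12, hblk, takeFn_boolPair]
    simp only [ones, List.length_replicate]
    exact runDF_apply hS hlp hk hτ false hz (by rw [List.length_take, hblkL]; omega)
  · rw [zE, Function.comp_apply, fanoutFn_apply, Function.comp_apply, fstF_boolPair, h8, Function.comp_apply, fanoutFn_apply,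
      Function.comp_apply, fstF_boolPair, h12, hblk, dropFn_boolPair]
    simp only [ones, List.length_replicate]
    exact runEF_apply hS hlp hk hτ false hz (by rw [List.length_drop, hblkL]; omega)

/-- The working record is long: `N + |cs| ≤ |wrec|` and more. [folklore] -/
theorem le_length_wrec (N t κ : ℕ) (τ : List (List Bool × Bool)) (cs : List Bool) :
    2 * N + cs.length + 8 ≤ (wrec N t κ τ cs).length := by
  have hN := length_unary' N
  simp only [wrec, hdr, length_boolPair, hN]
  omega

set_option maxHeartbeats 800000 in
/-- **Values of the counting folds**: `1^{cntD}` and `1^{cntE}`. [cite: HastadImpagliazzoLevinLuby1999, Lemma 6.3.2 (proof: the estimate Δ)] -/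
theorem cnts_apply (hS : ProgSpec P kcP mlenF) (hlp : IsLengthPreserving f) {N t : ℕ} (hk : 1 ≤ P.kc N)
    {τ : List (List Bool × Bool)} (hτ : ∀ q ∈ τ, q.1.length = N) {cs : List Bool} (hcs : cs.length = P.cE A NsP N t) :
    cntDF f A NsP kcP mlenF (wrec N t (P.κA A N t) τ cs) = ones (P.cntD f A NsP N t τ cs) ∧
      cntEF f A NsP kcP mlenF (wrec N t (P.κA A N t) τ cs) = ones (P.cntE f A NsP N t τ cs) := by
  obtain ⟨-, -, -, -, -, -, -, -, -, -, -, h15⟩ := eunits (A := A) (NsP := NsP) hS N t τ cs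
  have hinit : eInit NsP (wrec N t (P.κA A N t) τ cs) =
      boolPair (wrec N t (P.κA A N t) τ cs) (boolPair (encodeNat (NsP.eval N)) (boolPair (ones 0) [])) := by
    rw [eInit, fanoutFn_apply, fanoutFn_apply, Function.comp_apply, h15, lenBinF_apply]; simp [ones]
  have hlen := le_length_wrec N t (P.κA A N t) τ cs
  have hNs : NsP.eval N ≤ NsP.eval (wrec N t (P.κA A N t) τ cs).length := TM2Iter.eval_mono _ (by omega)
  have hpD : ∀ j, 0 ≤ j → j < 0 + NsP.eval N →
      (unaryBit (zD f A kcP mlenF) (boolPair (wrec N t (P.κA A N t) τ cs) (ones j))).length ≤ 1 * ((wrec N t (P.κA A N t) τ cs).length + 1) := by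
    intro j _ hj
    rw [unaryBit_apply (pieces_apply hS hlp hk hτ hcs (by omega)).1]
    cases P.runD f A N t τ false [] _ <;> simp [ones]
  have hpE : ∀ j, 0 ≤ j → j < 0 + NsP.eval N →
      (unaryBit (zE f A kcP mlenF) (boolPair (wrec N t (P.κA A N t) τ cs) (ones j))).length ≤ 1 * ((wrec N t (P.κA A N t) τ cs).length + 1) := by
    intro j _ hj
    rw [unaryBit_apply (pieces_apply hS hlp hk hτ hcs (by omega)).2]
    cases P.runE f A N t τ false [] _ <;> simp [ones]
  constructor
  · rw [cntDF, Function.comp_apply, Function.comp_apply, hinit, foldLoop_apply _ _ hNs 0, sndPow_succ_boolPair, sndPow_succ_boolPair,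
      sndPow_zero_boolPair, foldAcc_clipF hpD, foldAcc_appF, List.nil_append, Hybrid.ccat_eq_flatten_range, cntD, ← flatten_ones]
    exact congrArg List.flatten (List.map_congr_left fun j hj => by
      rw [zero_add, unaryBit_apply (pieces_apply hS hlp hk hτ hcs (List.mem_range.1 hj)).1])
  · rw [cntEF, Function.comp_apply, Function.comp_apply, hinit, foldLoop_apply _ _ hNs 0, sndPow_succ_boolPair, sndPow_succ_boolPair,
      sndPow_zero_boolPair, foldAcc_clipF hpE, foldAcc_appF, List.nil_append, Hybrid.ccat_eq_flatten_range, cntE, ← flatten_ones]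
    exact congrArg List.flatten (List.map_congr_left fun j hj => by
      rw [zero_add, unaryBit_apply (pieces_apply hS hlp hk hτ hcs (List.mem_range.1 hj)).2])

/-- **The counting folds are in `FP`.** [Arora–Barak 2009, §1.3–1.4] [folklore] -/
theorem cnts_mem_FP (hS : ProgSpec P kcP mlenF) (hf : f ∈ FP) (hA : IsPPT A encodeBool) :
    cntDF f A NsP kcP mlenF ∈ FP ∧ cntEF f A NsP kcP mlenF ∈ FP ∧ eY ∈ FP ∧ edT kcP mlenF ∈ FP ∧ eeT kcP mlenF ∈ FP ∧
      ecS kcP mlenF ∈ FP ∧ eNs NsP ∈ FP := by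
  obtain ⟨hrD, hrE⟩ := runs_mem_FP (A := A) hS hf hA
  have hCtx : eCtx ∈ FP := comp_mem_FP fstF_mem_FP fstF_mem_FP
  have hK : eK ∈ FP := comp_mem_FP sndF_mem_FP fstF_mem_FP
  have hTm : eTm ∈ FP := comp_mem_FP fstF_mem_FP sndF_mem_FP
  have hCs : eCs ∈ FP := comp_mem_FP sndF_mem_FP sndF_mem_FP
  have hN : eN ∈ FP := comp_mem_FP fstF_mem_FP (comp_mem_FP fstF_mem_FP fstF_mem_FP)
  have hY : eY ∈ FP := fanoutFn_mem_FP hCtx (fanoutFn_mem_FP hTm (const_mem_FP _))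
  have hQ : eQ ∈ FP := fanoutFn_mem_FP hY (const_mem_FP _)
  -- the units of `HILLGreedySamplers` are in FP (re-derived: they are short pipelines)
  have hNU : NU ∈ FP := comp_mem_FP fstF_mem_FP (comp_mem_FP fstF_mem_FP fstF_mem_FP)
  have hrl : rlU ∈ FP := comp_mem_FP (polyFn_mem_FP _) hNU
  have hKK : KKU ∈ FP := comp_mem_FP logFn_mem_FP hNU
  have hKN : KNU ∈ FP := comp_mem_FP HashBricks.umulFn_mem_FP (fanoutFn_mem_FP hKK hNU)
  have hNr : NrU ∈ FP := comp_mem_FP concatFn_mem_FP (fanoutFn_mem_FP hNU hrl)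
  have hNrK : NrKU ∈ FP := comp_mem_FP concatFn_mem_FP (fanoutFn_mem_FP hNr hKN)
  have hcP : cPU ∈ FP := comp_mem_FP concatFn_mem_FP (fanoutFn_mem_FP hNrK hKK)
  have hkkN : (polyFn (kcP ^ 3) ∘ NU) ∈ FP := comp_mem_FP (polyFn_mem_FP _) hNU
  have hkkc : kkcPU kcP ∈ FP := comp_mem_FP HashBricks.umulFn_mem_FP (fanoutFn_mem_FP hkkN hcP)
  have hml : mlU mlenF ∈ FP := comp_mem_FP hS.mlenF_mem (comp_mem_FP fstF_mem_FP fstF_mem_FP)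
  have huL : uLU kcP mlenF ∈ FP := comp_mem_FP HashBricks.umulFn_mem_FP (fanoutFn_mem_FP
    (comp_mem_FP (cons_mem_FP true) (comp_mem_FP HashBricks.umulFn_mem_FP (fanoutFn_mem_FP hkkN hKK))) hml)
  have hekk : ekk kcP ∈ FP := comp_mem_FP hkkc hQ
  have heuL : euL kcP mlenF ∈ FP := comp_mem_FP huL hQ
  have heml : eml mlenF ∈ FP := comp_mem_FP hml hQ
  have hdT : edT kcP mlenF ∈ FP :=
    comp_mem_FP concatFn_mem_FP (fanoutFn_mem_FP (comp_mem_FP concatFn_mem_FP (fanoutFn_mem_FP hekk heuL)) hK)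
  have heT : eeT kcP mlenF ∈ FP := comp_mem_FP concatFn_mem_FP (fanoutFn_mem_FP
    (comp_mem_FP concatFn_mem_FP (fanoutFn_mem_FP (comp_mem_FP concatFn_mem_FP (fanoutFn_mem_FP hekk heuL)) heml)) hK)
  have hcS : ecS kcP mlenF ∈ FP := comp_mem_FP concatFn_mem_FP (fanoutFn_mem_FP hdT heT)
  have hNs : eNs NsP ∈ FP := comp_mem_FP (polyFn_mem_FP _) hN
  have hblk : zBlk kcP mlenF ∈ FP := comp_mem_FP takeFn_mem_FP (fanoutFn_mem_FP (comp_mem_FP hcS fstF_mem_FP)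
    (comp_mem_FP dropFn_mem_FP (fanoutFn_mem_FP (comp_mem_FP HashBricks.umulFn_mem_FP (fanoutFn_mem_FP sndF_mem_FP
      (comp_mem_FP hcS fstF_mem_FP))) (comp_mem_FP hCs fstF_mem_FP))))
  have hzD : zD f A kcP mlenF ∈ FP := comp_mem_FP hrD (fanoutFn_mem_FP (comp_mem_FP hY fstF_mem_FP)
    (comp_mem_FP takeFn_mem_FP (fanoutFn_mem_FP (comp_mem_FP hdT fstF_mem_FP) hblk)))
  have hzE : zE f A kcP mlenF ∈ FP := comp_mem_FP hrE (fanoutFn_mem_FP (comp_mem_FP hY fstF_mem_FP)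
    (comp_mem_FP dropFn_mem_FP (fanoutFn_mem_FP (comp_mem_FP hdT fstF_mem_FP) hblk)))
  have hinit : eInit NsP ∈ FP := fanoutFn_mem_FP GGM.id_mem_FP' (fanoutFn_mem_FP (comp_mem_FP lenBinF_mem_FP hNs) (const_mem_FP _))
  exact ⟨comp_mem_FP (sndPow_mem_FP 2) (comp_mem_FP (foldLoop_clipF_mem_FP 1 appF_mem_FP length_appF_le (unaryBit_mem_FP hzD) NsP) hinit),
    comp_mem_FP (sndPow_mem_FP 2) (comp_mem_FP (foldLoop_clipF_mem_FP 1 appF_mem_FP length_appF_le (unaryBit_mem_FP hzE) NsP) hinit),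
    hY, hdT, heT, hcS, hNs⟩


/-! ### Programs, II: one stage of Phase 1 -/

variable (P f A NsP τnP kcP mlenF)

/-- `1^{b(N)}`. [folklore] -/
noncomputable def sB : List Bool → List Bool := List.cons true ∘ logFn ∘ eN
/-- The Bernoulli coins `coins ↾ b`. [folklore] -/
noncomputable def sCb : List Bool → List Bool := takeFn ∘ fanoutFn sB eCs
/-- The candidate coins `coins ⇂ b`. [folklore] -/
noncomputable def sRest : List Bool → List Bool := dropFn ∘ fanoutFn sB eCs
/-- **`[c]`, `c = [⟦coins ↾ b⟧ < t]`.** [cite: HastadImpagliazzoLevinLuby1999, Lemma 6.3.2 (proof: "choose c_j ∈ {0,1} so that c_j = 1 with probability p_n")] -/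
noncomputable def sC : List Bool → List Bool := ltLenF ∘ fanoutFn (binToUnaryFn ∘ fanoutFn eT sCb) eT
/-- `1^{cE}`. [folklore] -/
noncomputable def sCE : List Bool → List Bool := HashBricks.umulFn ∘ fanoutFn (eNs NsP) (ecS kcP mlenF)
/-- `1^{N + cE}` (one candidate block). [folklore] -/
noncomputable def sNcE : List Bool → List Bool := concatFn ∘ fanoutFn eN (sCE NsP kcP mlenF)
/-- `1^{τ(N)}`. [folklore] -/
noncomputable def sτn : List Bool → List Bool := polyFn τnP ∘ eN
/-- On `⟨v, 1^m⟩`: the `m`-th candidate block. [folklore] -/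
noncomputable def mBlk : List Bool → List Bool :=
  takeFn ∘ fanoutFn (sNcE NsP kcP mlenF ∘ fstF)
    (dropFn ∘ fanoutFn (HashBricks.umulFn ∘ fanoutFn sndF (sNcE NsP kcP mlenF ∘ fstF)) (sRest ∘ fstF))
/-- The candidate `w_m`. [cite: HastadImpagliazzoLevinLuby1999, Lemma 6.3.2 (proof: w_m = ⟨x̂_m, î_m⟩)] -/
noncomputable def mW : List Bool → List Bool := takeFn ∘ fanoutFn (eN ∘ fstF) (mBlk NsP kcP mlenF)
/-- Its estimation coins. [folklore] -/
noncomputable def mCe : List Bool → List Bool := dropFn ∘ fanoutFn (eN ∘ fstF) (mBlk NsP kcP mlenF)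
/-- The extended template `tmpl ‖ w_m ‖ [c]`. [folklore] -/
noncomputable def mTm : List Bool → List Bool := concatFn ∘ fanoutFn (concatFn ∘ fanoutFn (eTm ∘ fstF) (mW NsP kcP mlenF)) (sC ∘ fstF)
/-- The estimation record of candidate `m`. [folklore] -/
noncomputable def mRec : List Bool → List Bool := fanoutFn (eHdr ∘ fstF) (fanoutFn (mTm NsP kcP mlenF) (mCe NsP kcP mlenF))
/-- The fold piece `⟨⟨1^{cntD}, 1^{cntE}⟩, w_m⟩`. [folklore] -/
noncomputable def mPiece : List Bool → List Bool :=
  fanoutFn (fanoutFn (cntDF f A NsP kcP mlenF ∘ mRec NsP kcP mlenF) (cntEF f A NsP kcP mlenF ∘ mRec NsP kcP mlenF)) (mW NsP kcP mlenF)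
/-- On `⟨acc, piece⟩`: `[d* + e_m < d_m + e*]` (the new estimate is strictly larger). [folklore] -/
noncomputable def betF : List Bool → List Bool :=
  ltLenF ∘ fanoutFn (concatFn ∘ fanoutFn (fstF ∘ fstF ∘ fstF) (sndF ∘ fstF ∘ sndF))
    (concatFn ∘ fanoutFn (fstF ∘ fstF ∘ sndF) (sndF ∘ fstF ∘ fstF))
/-- **The selection step**: keep the strictly better of accumulator and piece. [cite: HastadImpagliazzoLevinLuby1999, Lemma 6.3.2 (proof: m₀)] -/
noncomputable def selOp : List Bool → List Bool := iteFn betF sndF fstF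
/-- The sentinel `⟨⟨ε, 1^{Ns+1}⟩, ε⟩`. [folklore] -/
noncomputable def sAcc0 : List Bool → List Bool := fanoutFn (fanoutFn (fun _ => []) (List.cons true ∘ eNs NsP)) (fun _ => [])
/-- Fold initial state. [folklore] -/
noncomputable def sInit : List Bool → List Bool :=
  fanoutFn (fun w => w) (fanoutFn (lenBinF ∘ sτn τnP) (fanoutFn (fun _ => []) (sAcc0 NsP)))
/-- **The selection fold** over the `τ(N)` candidates. [cite: HastadImpagliazzoLevinLuby1999, Lemma 6.3.2 (proof, Phase 1, stage j)] -/
noncomputable def selF : List Bool → List Bool := sndPow 2 ∘ foldLoop selOp (clipF 6 (mPiece f A NsP kcP mlenF)) τnP ∘ sInit NsP τnP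
/-- `1^{cS}` (coins of one stage). [folklore] -/
noncomputable def sCS : List Bool → List Bool := concatFn ∘ fanoutFn sB (HashBricks.umulFn ∘ fanoutFn (sτn τnP) (sNcE NsP kcP mlenF))
/-- **One stage**: extend the template by the selected candidate and the Bernoulli bit, consume `cS` coins.
[cite: HastadImpagliazzoLevinLuby1999, Lemma 6.3.2 (proof, Phase 1, stage j)] -/
noncomputable def stgF : List Bool → List Bool :=
  fanoutFn eHdr (fanoutFn (concatFn ∘ fanoutFn (concatFn ∘ fanoutFn eTm (sndF ∘ selF f A NsP τnP kcP mlenF)) sC)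
    (dropFn ∘ fanoutFn (sCS NsP τnP kcP mlenF) eCs))

variable {P f A NsP τnP kcP mlenF}

/-- The encoding of a fold state. [folklore] -/
def encSt (st : ℕ × ℕ × List Bool) : List Bool := boolPair (boolPair (ones st.1) (ones st.2.1)) st.2.2

/-- `betF` is one-bit, so `selOp` is a total selection. [folklore] -/
theorem selOp_eq (w : List Bool) : selOp w = if betF w = [true] then sndF w else fstF w :=
  iteFn_of_oneBit (oneBit_ltLenF.comp _) _ _ w

/-- Growth of `selOp`: none. [folklore] -/
theorem length_selOp_le (w : List Bool) : (selOp w).length ≤ (fstF w).length + (sndF w).length + 0 := by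
  rw [selOp_eq]; split_ifs <;> omega

/-- **Value of the selection step.** [folklore] -/
theorem selOp_apply (d e dm em : ℕ) (w wm : List Bool) :
    selOp (boolPair (encSt (d, e, w)) (boolPair (boolPair (ones dm) (ones em)) wm)) =
      if d + em < dm + e then boolPair (boolPair (ones dm) (ones em)) wm else encSt (d, e, w) := by
  have hb : betF (boolPair (encSt (d, e, w)) (boolPair (boolPair (ones dm) (ones em)) wm)) = [decide (d + em < dm + e)] := by
    simp [betF, encSt, ones]
  rw [selOp, iteFn_apply hb, sndF_boolPair, fstF_boolPair]
  by_cases h : d + em < dm + e <;> simp [h]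

/-- `1 ≤ cSamp` (indeed `12 ≤ cSamp`) once `1 ≤ kc N`. [folklore] -/
theorem one_le_cSamp {N : ℕ} (hk : 1 ≤ P.kc N) (t : ℕ) : 1 ≤ P.cSamp A N t := by
  have hkk : 1 ≤ P.kk N := Nat.one_le_pow _ _ hk
  have hcP : 1 ≤ cP N := by unfold cP rlen; nlinarith
  have : 1 ≤ P.kk N * cP N := Nat.one_le_iff_ne_zero.2 (Nat.mul_ne_zero (by omega) (by omega))
  unfold cSamp dTot; omega

/-- Lengths of the candidate pieces. [folklore] -/
theorem length_blockOf {N t : ℕ} {Rr : List Bool} {m : ℕ}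
    (hR : bLen N + (m + 1) * (N + P.cE A NsP N t) ≤ Rr.length) :
    ((P.QM f A NsP τnP N t).blockOf Rr m).length = N + P.cE A NsP N t ∧ ((P.QM f A NsP τnP N t).cand Rr m).length = N ∧
      ((P.QM f A NsP τnP N t).ceOf Rr m).length = P.cE A NsP N t := by
  have h1 : ((P.QM f A NsP τnP N t).blockOf Rr m).length = N + P.cE A NsP N t := by
    simp only [Greedy.Data.blockOf, QM, List.length_take, List.length_drop]
    rw [Nat.succ_mul] at hR; omega
  refine ⟨h1, ?_, ?_⟩
  · simp only [Greedy.Data.cand, List.length_take, h1]; omega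
  · simp only [Greedy.Data.ceOf, List.length_drop, h1]; omega

set_option maxHeartbeats 800000 in
/-- **Values of the stage-level units** on a working record. [folklore] -/
theorem sunits (hS : ProgSpec P kcP mlenF) (N t : ℕ) (τ : List (List Bool × Bool)) (Rr : List Bool) :
    let v := wrec N t (P.κA A N t) τ Rr
    sB v = ones (bLen N) ∧ sCb v = Rr.take (bLen N) ∧ sRest v = Rr.drop (bLen N) ∧ sC v = [(P.QM f A NsP τnP N t).cOf Rr] ∧
      sCE NsP kcP mlenF v = ones (P.cE A NsP N t) ∧ sNcE NsP kcP mlenF v = ones (N + P.cE A NsP N t) ∧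
      sτn τnP v = ones (τnP.eval N) ∧ sCS NsP τnP kcP mlenF v = ones (P.QM f A NsP τnP N t).cS ∧
      sAcc0 NsP v = encSt (P.selSt f A NsP τnP N t τ Rr 0) := by
  intro v
  obtain ⟨-, -, -, -, h5, h6, h7, -, -, -, h14, h15⟩ := eunits (A := A) (NsP := NsP) hS N t τ Rr
  have hN := length_unary' N
  have hb : sB v = ones (bLen N) := by
    rw [sB, Function.comp_apply, Function.comp_apply, h6, logFn, hN, bLen]; simp [ones, List.replicate_succ]
  have hcb : sCb v = Rr.take (bLen N) := by rw [sCb, Function.comp_apply, fanoutFn_apply, hb, h5, takeFn_boolPair]; simp [ones]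
  have hrest : sRest v = Rr.drop (bLen N) := by rw [sRest, Function.comp_apply, fanoutFn_apply, hb, h5, dropFn_boolPair]; simp [ones]
  have hc : sC v = [(P.QM f A NsP τnP N t).cOf Rr] := by
    rw [sC, Function.comp_apply, fanoutFn_apply, Function.comp_apply, fanoutFn_apply, h7, hcb, binToUnaryFn_boolPair, ltLenF_boolPair,
      length_unary' t]
    simp only [ones, List.length_replicate, Greedy.Data.cOf, QM, min_lt_iff, lt_self_iff_false, or_false]
    by_cases h : bitsToNat (Rr.take (bLen N)) < t <;> simp [h]
  have hcE : sCE NsP kcP mlenF v = ones (P.cE A NsP N t) := by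
    rw [sCE, Function.comp_apply, fanoutFn_apply, h15, h14, HashBricks.umulFn_apply, fstF_boolPair, sndF_boolPair, cE]; simp [ones]
  have hNcE : sNcE NsP kcP mlenF v = ones (N + P.cE A NsP N t) := by
    rw [sNcE, Function.comp_apply, fanoutFn_apply, h6, hcE, concatFn_boolPair, unary_eq_ones, Com.ones_append]
  have hτn : sτn τnP v = ones (τnP.eval N) := by rw [sτn, Function.comp_apply, h6, polyFn_apply, hN]
  have hcS : sCS NsP τnP kcP mlenF v = ones (P.QM f A NsP τnP N t).cS := by
    rw [sCS, Function.comp_apply, fanoutFn_apply, hb, Function.comp_apply, fanoutFn_apply, hτn, hNcE, HashBricks.umulFn_apply, fstF_boolPair,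
      sndF_boolPair, concatFn_boolPair]
    simp only [ones, List.length_replicate, List.replicate_append_replicate, Greedy.Data.cS, QM]
  have hacc : sAcc0 NsP v = encSt (P.selSt f A NsP τnP N t τ Rr 0) := by
    rw [sAcc0, fanoutFn_apply, fanoutFn_apply, Function.comp_apply, h15, selSt, encSt]; simp [ones, List.replicate_succ]
  exact ⟨hb, hcb, hrest, hc, hcE, hNcE, hτn, hcS, hacc⟩

set_option maxHeartbeats 1600000 in
/-- **Value of the fold piece** of candidate `m < τ(N)` (enough coins). [folklore] -/
theorem mPiece_apply (hS : ProgSpec P kcP mlenF) (hlp : IsLengthPreserving f) {N t : ℕ} (hk : 1 ≤ P.kc N)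
    {τ : List (List Bool × Bool)} (hτ : ∀ q ∈ τ, q.1.length = N) {Rr : List Bool} (hR : (P.QM f A NsP τnP N t).cS ≤ Rr.length)
    {m : ℕ} (hm : m < τnP.eval N) :
    let Q := P.QM f A NsP τnP N t
    mRec NsP kcP mlenF (boolPair (wrec N t (P.κA A N t) τ Rr) (ones m)) =
        wrec N t (P.κA A N t) (τ ++ [(Q.cand Rr m, Q.cOf Rr)]) (Q.ceOf Rr m) ∧
      mW NsP kcP mlenF (boolPair (wrec N t (P.κA A N t) τ Rr) (ones m)) = Q.cand Rr m ∧
      mPiece f A NsP kcP mlenF (boolPair (wrec N t (P.κA A N t) τ Rr) (ones m)) =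
        boolPair (boolPair (ones (P.cntD f A NsP N t (τ ++ [(Q.cand Rr m, Q.cOf Rr)]) (Q.ceOf Rr m)))
          (ones (P.cntE f A NsP N t (τ ++ [(Q.cand Rr m, Q.cOf Rr)]) (Q.ceOf Rr m)))) (Q.cand Rr m) := by
  intro Q
  obtain ⟨h1, -, -, h4, -, h6, -, -, -, -, -, -⟩ := eunits (A := A) (NsP := NsP) hS N t τ Rr
  obtain ⟨-, -, hrest, hc, -, hNcE, -, -, -⟩ := sunits (f := f) (A := A) (NsP := NsP) (τnP := τnP) hS N t τ Rr
  have hN := length_unary' N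
  have hRm : bLen N + (m + 1) * (N + P.cE A NsP N t) ≤ Rr.length := by
    refine le_trans ?_ hR
    simp only [Greedy.Data.cS, QM]
    exact Nat.add_le_add_left (Nat.mul_le_mul_right _ hm) _
  obtain ⟨hblen, hwlen, hcelen⟩ := length_blockOf (P := P) (f := f) (A := A) (NsP := NsP) (τnP := τnP) hRm
  have hblk : mBlk NsP kcP mlenF (boolPair (wrec N t (P.κA A N t) τ Rr) (ones m)) = Q.blockOf Rr m := by
    rw [mBlk, Function.comp_apply, fanoutFn_apply, Function.comp_apply, fstF_boolPair, hNcE, Function.comp_apply, fanoutFn_apply,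
      Function.comp_apply, fanoutFn_apply, sndF_boolPair, Function.comp_apply, fstF_boolPair, hNcE, HashBricks.umulFn_apply, fstF_boolPair,
      sndF_boolPair, Function.comp_apply, fstF_boolPair, hrest, dropFn_boolPair, takeFn_boolPair]
    simp only [ones, List.length_replicate, List.drop_drop, Greedy.Data.blockOf, Q, QM]
  have hw : mW NsP kcP mlenF (boolPair (wrec N t (P.κA A N t) τ Rr) (ones m)) = Q.cand Rr m := by
    rw [mW, Function.comp_apply, fanoutFn_apply, Function.comp_apply, fstF_boolPair, h6, hblk, takeFn_boolPair, hN]; rfl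
  have hce : mCe NsP kcP mlenF (boolPair (wrec N t (P.κA A N t) τ Rr) (ones m)) = Q.ceOf Rr m := by
    rw [mCe, Function.comp_apply, fanoutFn_apply, Function.comp_apply, fstF_boolPair, h6, hblk, dropFn_boolPair, hN]; rfl
  have htm : mTm NsP kcP mlenF (boolPair (wrec N t (P.κA A N t) τ Rr) (ones m)) = encT (τ ++ [(Q.cand Rr m, Q.cOf Rr)]) := by
    rw [mTm, Function.comp_apply, fanoutFn_apply, Function.comp_apply, fanoutFn_apply, Function.comp_apply, fstF_boolPair, h4, hw,
      Function.comp_apply, fstF_boolPair, hc, concatFn_boolPair, concatFn_boolPair, encT_append, List.append_assoc]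
  have hX : mRec NsP kcP mlenF (boolPair (wrec N t (P.κA A N t) τ Rr) (ones m)) = wrec N t (P.κA A N t) (τ ++ [(Q.cand Rr m, Q.cOf Rr)]) (Q.ceOf Rr m) := by
    rw [mRec, fanoutFn_apply, fanoutFn_apply, Function.comp_apply, fstF_boolPair, h1, htm, hce, wrec]
  have hτ' : ∀ q ∈ τ ++ [(Q.cand Rr m, Q.cOf Rr)], q.1.length = N := by
    intro q hq
    rcases List.mem_append.1 hq with hq | hq
    · exact hτ q hq
    · rw [List.mem_singleton.1 hq]; exact hwlen
  obtain ⟨hD, hE⟩ := cnts_apply (NsP := NsP) hS hlp hk hτ' hcelen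
  refine ⟨hX, hw, ?_⟩
  rw [mPiece, fanoutFn_apply, fanoutFn_apply, Function.comp_apply, hX, hD, Function.comp_apply, hX, hE, hw]

/-- The working record dominates `N`, `Ns` and the coins. [folklore] -/
theorem le_length_wrec' {N : ℕ} (hk : 1 ≤ P.kc N) (hτn : 1 ≤ τnP.eval N) (t : ℕ) (τ : List (List Bool × Bool))
    {Rr : List Bool} (hR : (P.QM f A NsP τnP N t).cS ≤ Rr.length) :
    N + NsP.eval N ≤ Rr.length ∧ 2 * N + Rr.length + 8 ≤ (wrec N t (P.κA A N t) τ Rr).length := by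
  have h1 := le_length_wrec N t (P.κA A N t) τ Rr
  have h2 : N + NsP.eval N ≤ (P.QM f A NsP τnP N t).cS := by
    have hc := one_le_cSamp (P := P) (A := A) hk t
    simp only [Greedy.Data.cS, QM, cE]
    calc N + NsP.eval N ≤ N + NsP.eval N * P.cSamp A N t := Nat.add_le_add_left (Nat.le_mul_of_pos_right _ hc) _
      _ ≤ τnP.eval N * (N + NsP.eval N * P.cSamp A N t) := Nat.le_mul_of_pos_left _ hτn
      _ ≤ _ := Nat.le_add_left _ _
  omega

set_option maxHeartbeats 1600000 in
/-- **The selection fold computes `selSt`.** [folklore] -/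
theorem foldAcc_sel (hS : ProgSpec P kcP mlenF) (hlp : IsLengthPreserving f) {N t : ℕ} (hk : 1 ≤ P.kc N)
    {τ : List (List Bool × Bool)} (hτ : ∀ q ∈ τ, q.1.length = N) {Rr : List Bool} (hR : (P.QM f A NsP τnP N t).cS ≤ Rr.length) :
    ∀ {m : ℕ}, m ≤ τnP.eval N →
      foldAcc selOp (mPiece f A NsP kcP mlenF) (wrec N t (P.κA A N t) τ Rr) 0 m (encSt (P.selSt f A NsP τnP N t τ Rr 0)) =
        encSt (P.selSt f A NsP τnP N t τ Rr m)
  | 0, _ => rfl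
  | m + 1, hm => by
    rw [foldAcc_succ', foldAcc_sel hS hlp hk hτ hR (Nat.le_of_succ_le hm), zero_add,
      (mPiece_apply hS hlp hk hτ hR (Nat.lt_of_succ_le hm)).2.2]
    rcases hst : P.selSt f A NsP τnP N t τ Rr m with ⟨d, e, w⟩
    rw [selOp_apply]
    simp only [selSt, hst]
    split_ifs <;> rfl

set_option maxHeartbeats 1600000 in
/-- **Value of one stage**: the abstract stage of `HILLGreedySelection` on the data `QM`, and `cS` coins consumed.
[cite: HastadImpagliazzoLevinLuby1999, Lemma 6.3.2 (proof, Phase 1, stage j)] -/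
theorem stgF_apply (hS : ProgSpec P kcP mlenF) (hlp : IsLengthPreserving f) {N t : ℕ} (hk : 1 ≤ P.kc N) (hτn : 1 ≤ τnP.eval N)
    {τ : List (List Bool × Bool)} (hτ : ∀ q ∈ τ, q.1.length = N) {Rr : List Bool} (hR : (P.QM f A NsP τnP N t).cS ≤ Rr.length) :
    stgF f A NsP τnP kcP mlenF (wrec N t (P.κA A N t) τ Rr) =
      wrec N t (P.κA A N t) ((P.QM f A NsP τnP N t).stage τ Rr) (Rr.drop (P.QM f A NsP τnP N t).cS) := by
  obtain ⟨h1, -, -, h4, h5, -, -, -, -, -, -, -⟩ := eunits (A := A) (NsP := NsP) hS N t τ Rr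
  obtain ⟨-, -, -, hc, -, -, hτnU, hcS, hacc⟩ := sunits (f := f) (A := A) (NsP := NsP) (τnP := τnP) hS N t τ Rr
  obtain ⟨hNsR, hlen⟩ := le_length_wrec' (P := P) (f := f) (A := A) (NsP := NsP) (τnP := τnP) hk hτn t τ hR
  have hinit : sInit NsP τnP (wrec N t (P.κA A N t) τ Rr) = boolPair (wrec N t (P.κA A N t) τ Rr)
      (boolPair (encodeNat (τnP.eval N)) (boolPair (ones 0) (encSt (P.selSt f A NsP τnP N t τ Rr 0)))) := by
    rw [sInit, fanoutFn_apply, fanoutFn_apply, fanoutFn_apply, Function.comp_apply, hτnU, lenBinF_apply, hacc]; simp [ones]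
  have hτM : τnP.eval N ≤ τnP.eval (wrec N t (P.κA A N t) τ Rr).length := TM2Iter.eval_mono _ (by omega)
  have hpieces : ∀ j, 0 ≤ j → j < 0 + τnP.eval N →
      (mPiece f A NsP kcP mlenF (boolPair (wrec N t (P.κA A N t) τ Rr) (ones j))).length ≤ 6 * ((wrec N t (P.κA A N t) τ Rr).length + 1) := by
    intro j _ hj
    rw [(mPiece_apply hS hlp hk hτ hR (by omega)).2.2]
    have hRm : bLen N + (j + 1) * (N + P.cE A NsP N t) ≤ Rr.length := by
      refine le_trans ?_ hR
      simp only [Greedy.Data.cS, QM]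
      exact Nat.add_le_add_left (Nat.mul_le_mul_right _ (by omega)) _
    obtain ⟨-, hwlen, -⟩ := length_blockOf (P := P) (f := f) (A := A) (NsP := NsP) (τnP := τnP) hRm
    have hD := cntD_le (P := P) (f := f) (A := A) (NsP := NsP) N t (τ ++ [((P.QM f A NsP τnP N t).cand Rr j, (P.QM f A NsP τnP N t).cOf Rr)]) ((P.QM f A NsP τnP N t).ceOf Rr j)
    have hE := cntE_le (P := P) (f := f) (A := A) (NsP := NsP) N t (τ ++ [((P.QM f A NsP τnP N t).cand Rr j, (P.QM f A NsP τnP N t).cOf Rr)]) ((P.QM f A NsP τnP N t).ceOf Rr j)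
    simp only [length_boolPair, ones, List.length_replicate, hwlen]
    omega
  have hsel : selF f A NsP τnP kcP mlenF (wrec N t (P.κA A N t) τ Rr) = encSt (P.selSt f A NsP τnP N t τ Rr (τnP.eval N)) := by
    rw [selF, Function.comp_apply, Function.comp_apply, hinit, foldLoop_apply _ _ hτM 0, sndPow_succ_boolPair, sndPow_succ_boolPair,
      sndPow_zero_boolPair, foldAcc_clipF hpieces, foldAcc_sel hS hlp hk hτ hR le_rfl]
  have hchoice : sndF (selF f A NsP τnP kcP mlenF (wrec N t (P.κA A N t) τ Rr)) = ((P.QM f A NsP τnP N t).choice τ Rr).1 := by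
    obtain ⟨n, hn⟩ : ∃ n, τnP.eval N = n + 1 := ⟨τnP.eval N - 1, by omega⟩
    rw [hsel, hn, selSt_succ, encSt, sndF_boolPair, Greedy.Data.choice, argmaxFirst_estv]
    simp only [show (P.QM f A NsP τnP N t).τn = τnP.eval N from rfl, hn]
  rw [stgF, fanoutFn_apply, fanoutFn_apply, Function.comp_apply, fanoutFn_apply, Function.comp_apply, fanoutFn_apply, h1, h4,
    Function.comp_apply, hchoice, hc, Function.comp_apply, fanoutFn_apply, hcS, h5, concatFn_boolPair, concatFn_boolPair, dropFn_boolPair,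
    wrec, Greedy.Data.stage, encT_append, List.append_assoc]
  simp only [ones, List.length_replicate]
  rfl

/-- **The stage does not lengthen the record** (`2N + 2 ≤ cS ≤ |coins|`). [folklore] -/
theorem length_stgF_le (hS : ProgSpec P kcP mlenF) (hlp : IsLengthPreserving f) {N t : ℕ} (hk : 1 ≤ P.kc N) (hτn : 1 ≤ τnP.eval N)
    {τ : List (List Bool × Bool)} (hτ : ∀ q ∈ τ, q.1.length = N) {Rr : List Bool} (hR : (P.QM f A NsP τnP N t).cS ≤ Rr.length)
    (h2N : 2 * N + 2 ≤ (P.QM f A NsP τnP N t).cS) :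
    (stgF f A NsP τnP kcP mlenF (wrec N t (P.κA A N t) τ Rr)).length ≤ (wrec N t (P.κA A N t) τ Rr).length := by
  rw [stgF_apply hS hlp hk hτn hτ hR]
  have hRm : bLen N + (Greedy.Data.argmaxFirst ((P.QM f A NsP τnP N t).estv τ Rr) (τnP.eval N) + 1) * (N + P.cE A NsP N t) ≤ Rr.length := by
    refine le_trans ?_ hR
    simp only [Greedy.Data.cS, QM]
    exact Nat.add_le_add_left (Nat.mul_le_mul_right _ (Greedy.Data.argmaxFirst_lt _ hτn)) _
  obtain ⟨-, hwlen, -⟩ := length_blockOf (P := P) (f := f) (A := A) (NsP := NsP) (τnP := τnP) hRm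
  have hT : (encT ((P.QM f A NsP τnP N t).stage τ Rr)).length = (encT τ).length + (N + 1) := by
    rw [Greedy.Data.stage, encT_append, List.length_append, List.length_append, List.length_singleton, Greedy.Data.choice]
    simp only [show (P.QM f A NsP τnP N t).τn = τnP.eval N from rfl, hwlen]
  simp only [wrec, length_boolPair, hT, List.length_drop]
  omega

set_option maxHeartbeats 1600000 in
/-- **The stage programs are in `FP`.** [Arora–Barak 2009, §1.3–1.4] [folklore] -/
theorem stgF_mem_FP (hS : ProgSpec P kcP mlenF) (hf : f ∈ FP) (hA : IsPPT A encodeBool) :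
    stgF f A NsP τnP kcP mlenF ∈ FP ∧ sC ∈ FP ∧ sCS NsP τnP kcP mlenF ∈ FP := by
  obtain ⟨hcD, hcE, -, -, -, hcS, hNs⟩ := cnts_mem_FP (NsP := NsP) hS hf hA
  have hHdr : eHdr ∈ FP := fstF_mem_FP
  have hTm : eTm ∈ FP := comp_mem_FP fstF_mem_FP sndF_mem_FP
  have hCs : eCs ∈ FP := comp_mem_FP sndF_mem_FP sndF_mem_FP
  have hN : eN ∈ FP := comp_mem_FP fstF_mem_FP (comp_mem_FP fstF_mem_FP fstF_mem_FP)
  have hT : eT ∈ FP := comp_mem_FP sndF_mem_FP (comp_mem_FP fstF_mem_FP fstF_mem_FP)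
  have hB : sB ∈ FP := comp_mem_FP (cons_mem_FP true) (comp_mem_FP logFn_mem_FP hN)
  have hCb : sCb ∈ FP := comp_mem_FP takeFn_mem_FP (fanoutFn_mem_FP hB hCs)
  have hRest : sRest ∈ FP := comp_mem_FP dropFn_mem_FP (fanoutFn_mem_FP hB hCs)
  have hC : sC ∈ FP := comp_mem_FP ltLenF_mem_FP (fanoutFn_mem_FP (comp_mem_FP binToUnaryFn_mem_FP (fanoutFn_mem_FP hT hCb)) hT)
  have hCE : sCE NsP kcP mlenF ∈ FP := comp_mem_FP HashBricks.umulFn_mem_FP (fanoutFn_mem_FP hNs hcS)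
  have hNcE : sNcE NsP kcP mlenF ∈ FP := comp_mem_FP concatFn_mem_FP (fanoutFn_mem_FP hN hCE)
  have hτn : sτn τnP ∈ FP := comp_mem_FP (polyFn_mem_FP _) hN
  have hBlk : mBlk NsP kcP mlenF ∈ FP := comp_mem_FP takeFn_mem_FP (fanoutFn_mem_FP (comp_mem_FP hNcE fstF_mem_FP)
    (comp_mem_FP dropFn_mem_FP (fanoutFn_mem_FP (comp_mem_FP HashBricks.umulFn_mem_FP (fanoutFn_mem_FP sndF_mem_FP
      (comp_mem_FP hNcE fstF_mem_FP))) (comp_mem_FP hRest fstF_mem_FP))))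
  have hW : mW NsP kcP mlenF ∈ FP := comp_mem_FP takeFn_mem_FP (fanoutFn_mem_FP (comp_mem_FP hN fstF_mem_FP) hBlk)
  have hCe : mCe NsP kcP mlenF ∈ FP := comp_mem_FP dropFn_mem_FP (fanoutFn_mem_FP (comp_mem_FP hN fstF_mem_FP) hBlk)
  have hTm' : mTm NsP kcP mlenF ∈ FP := comp_mem_FP concatFn_mem_FP (fanoutFn_mem_FP
    (comp_mem_FP concatFn_mem_FP (fanoutFn_mem_FP (comp_mem_FP hTm fstF_mem_FP) hW)) (comp_mem_FP hC fstF_mem_FP))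
  have hX : mRec NsP kcP mlenF ∈ FP := fanoutFn_mem_FP (comp_mem_FP hHdr fstF_mem_FP) (fanoutFn_mem_FP hTm' hCe)
  have hPiece : mPiece f A NsP kcP mlenF ∈ FP := fanoutFn_mem_FP (fanoutFn_mem_FP (comp_mem_FP hcD hX) (comp_mem_FP hcE hX)) hW
  have hf3 : (fstF ∘ fstF ∘ fstF : List Bool → List Bool) ∈ FP := comp_mem_FP fstF_mem_FP (comp_mem_FP fstF_mem_FP fstF_mem_FP)
  have hsfs : (sndF ∘ fstF ∘ sndF : List Bool → List Bool) ∈ FP := comp_mem_FP sndF_mem_FP (comp_mem_FP fstF_mem_FP sndF_mem_FP)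
  have hffs : (fstF ∘ fstF ∘ sndF : List Bool → List Bool) ∈ FP := comp_mem_FP fstF_mem_FP (comp_mem_FP fstF_mem_FP sndF_mem_FP)
  have hsff : (sndF ∘ fstF ∘ fstF : List Bool → List Bool) ∈ FP := comp_mem_FP sndF_mem_FP (comp_mem_FP fstF_mem_FP fstF_mem_FP)
  have hbet : betF ∈ FP := comp_mem_FP ltLenF_mem_FP (fanoutFn_mem_FP (comp_mem_FP concatFn_mem_FP (fanoutFn_mem_FP hf3 hsfs))
    (comp_mem_FP concatFn_mem_FP (fanoutFn_mem_FP hffs hsff)))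
  have hop : selOp ∈ FP := iteFn_mem_FP hbet sndF_mem_FP fstF_mem_FP
  have hacc : sAcc0 NsP ∈ FP := fanoutFn_mem_FP (fanoutFn_mem_FP (const_mem_FP _) (comp_mem_FP (cons_mem_FP true) hNs)) (const_mem_FP _)
  have hinit : sInit NsP τnP ∈ FP :=
    fanoutFn_mem_FP GGM.id_mem_FP' (fanoutFn_mem_FP (comp_mem_FP lenBinF_mem_FP hτn) (fanoutFn_mem_FP (const_mem_FP _) hacc))
  have hsel : selF f A NsP τnP kcP mlenF ∈ FP :=
    comp_mem_FP (sndPow_mem_FP 2) (comp_mem_FP (foldLoop_clipF_mem_FP 6 hop length_selOp_le hPiece τnP) hinit)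
  have hcSS : sCS NsP τnP kcP mlenF ∈ FP :=
    comp_mem_FP concatFn_mem_FP (fanoutFn_mem_FP hB (comp_mem_FP HashBricks.umulFn_mem_FP (fanoutFn_mem_FP hτn hNcE)))
  exact ⟨fanoutFn_mem_FP hHdr (fanoutFn_mem_FP (comp_mem_FP concatFn_mem_FP (fanoutFn_mem_FP
    (comp_mem_FP concatFn_mem_FP (fanoutFn_mem_FP hTm (comp_mem_FP sndF_mem_FP hsel))) hC)) (comp_mem_FP dropFn_mem_FP
      (fanoutFn_mem_FP hcSS hCs))), hC, hcSS⟩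


/-! ### Programs, III: Phase 1 (the stages iterated), Phase 2 and the machine -/

variable (P f A NsP τnP kcP mlenF) (Kb : Polynomial ℕ)

/-- One clamped round `⟨clock, v⟩ ↦ ⟨clock, stage v⟩`. [folklore] -/
noncomputable def rndF : List Bool → List Bool := PRGStretch.clampAdd 0 (mapSndFn (stgF f A NsP τnP kcP mlenF))
/-- **Phase 1**: `|clock|` rounds. [cite: HastadImpagliazzoLevinLuby1999, Lemma 6.3.2 (proof, Phase 1: "Stage j = 1, …, k_n")] -/
noncomputable def ph1F : List Bool → List Bool :=
  fun z => (rndF f A NsP τnP kcP mlenF)^[(X : Polynomial ℕ).eval (boolUnpair z).1.length] z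
/-- `1^N` (from `⟨⟨1^N, z⟩, R⟩`). [folklore] -/
noncomputable def tN : List Bool → List Bool := fstF ∘ fstF
/-- the atom `z`. [folklore] -/
noncomputable def tZ : List Bool → List Bool := sndF ∘ fstF
/-- `⟨1^{|R| / Kb}, 1^{|R| mod Kb}⟩`. [folklore] -/
noncomputable def tDm1 : List Bool → List Bool := divModFn ∘ fanoutFn (polyFn Kb ∘ tN) (onesFn ∘ sndF)
/-- the advice `1^t`. [cite: HastadImpagliazzoLevinLuby1999, Def. 3.1.1 (mildly non-uniform: the advice aₙ)] -/
noncomputable def tT : List Bool → List Bool := sndF ∘ tDm1 Kb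
/-- `1^{k+1}`. [folklore] -/
noncomputable def tB2 : List Bool → List Bool := List.cons true ∘ polyFn (kcP ^ 3) ∘ tN
/-- `⟨1^{κ+1}, 1^{j}⟩`. [folklore] -/
noncomputable def tDm2 : List Bool → List Bool := divModFn ∘ fanoutFn (tB2 kcP) (fstF ∘ tDm1 Kb)
/-- the advice `1^j` (the Phase-2 index). [folklore] -/
noncomputable def tJ : List Bool → List Bool := sndF ∘ tDm2 kcP Kb
/-- the advice `1^κ` (`A`'s coin count). [folklore] -/
noncomputable def tK : List Bool → List Bool := dropFn ∘ fanoutFn (fun _ => [true]) (fstF ∘ tDm2 kcP Kb)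
/-- `ctx`. [folklore] -/
noncomputable def tCtx : List Bool → List Bool := fanoutFn tN (tT Kb)
/-- `hdr`. [folklore] -/
noncomputable def tHdr : List Bool → List Bool := fanoutFn (tCtx Kb) (tK kcP Kb)
/-- The Phase-1 start state `⟨1^j, ⟨hdr, ⟨ε, R⟩⟩⟩`. [folklore] -/
noncomputable def tS0 : List Bool → List Bool := fanoutFn (tJ kcP Kb) (fanoutFn (tHdr kcP Kb) (fanoutFn (fun _ => []) sndF))
/-- The working record after Phase 1. [folklore] -/
noncomputable def tV1 : List Bool → List Bool := sndF ∘ ph1F f A NsP τnP kcP mlenF ∘ tS0 kcP Kb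
/-- `Y = ⟨ctx, ⟨T_j, ⟨[true], z⟩⟩⟩` (challenge planted at position `j + 1`). [cite: HastadImpagliazzoLevinLuby1999, Lemma 6.3.2 (proof, Phase 2: 𝒟^{(j)}(w,r,b,y))] -/
noncomputable def tY : List Bool → List Bool :=
  fanoutFn (tCtx Kb) (fanoutFn (eTm ∘ tV1 f A NsP τnP kcP mlenF Kb) (fanoutFn (fun _ => [true]) tZ))
/-- The coins left after Phase 1. [folklore] -/
noncomputable def tRr : List Bool → List Bool := eCs ∘ tV1 f A NsP τnP kcP mlenF Kb
/-- Coins of the Phase-2 `𝒟`-run. [folklore] -/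
noncomputable def tRD : List Bool → List Bool := takeFn ∘ fanoutFn (edT kcP mlenF ∘ tV1 f A NsP τnP kcP mlenF Kb) (tRr f A NsP τnP kcP mlenF Kb)
/-- Coins of the Phase-2 `ℰ`-run. [folklore] -/
noncomputable def tRE : List Bool → List Bool :=
  takeFn ∘ fanoutFn (eeT kcP mlenF ∘ tV1 f A NsP τnP kcP mlenF Kb)
    (dropFn ∘ fanoutFn (edT kcP mlenF ∘ tV1 f A NsP τnP kcP mlenF Kb) (tRr f A NsP τnP kcP mlenF Kb))
/-- `[β]`. [folklore] -/
noncomputable def tBeta : List Bool → List Bool :=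
  takeFn ∘ fanoutFn (fun _ => [true]) (dropFn ∘ fanoutFn (ecS kcP mlenF ∘ tV1 f A NsP τnP kcP mlenF Kb) (tRr f A NsP τnP kcP mlenF Kb))
/-- `[A(D)]`. [folklore] -/
noncomputable def tAD : List Bool → List Bool := runDF f kcP mlenF A ∘ fanoutFn (tY f A NsP τnP kcP mlenF Kb) (tRD f A NsP τnP kcP mlenF Kb)
/-- `[A(E)]`. [folklore] -/
noncomputable def tAE : List Bool → List Bool := runEF f kcP mlenF A ∘ fanoutFn (tY f A NsP τnP kcP mlenF Kb) (tRE f A NsP τnP kcP mlenF Kb)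
/-- **The output bit**: `β` if `A(D) = A(E)`, else `A(D)`. [cite: HastadImpagliazzoLevinLuby1999, Lemma 6.3.2 (proof, Phase 2: "If A(D) = A(E) then output β else output A(D)")] -/
noncomputable def outF : List Bool → List Bool :=
  iteFn (tAD f A NsP τnP kcP mlenF Kb) (iteFn (tAE f A NsP τnP kcP mlenF Kb) (tBeta f A NsP τnP kcP mlenF Kb) (fun _ => [true]))
    (iteFn (tAE f A NsP τnP kcP mlenF Kb) (fun _ => [false]) (tBeta f A NsP τnP kcP mlenF Kb))
/-- The output bit in unary (`1^{bit}`; a total normalisation of the pipeline's output). [folklore] -/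
noncomputable def coreM : List Bool → List Bool := unaryBit (outF f A NsP τnP kcP mlenF Kb)

/-- **HILL's adversary `M^{(A)}`** (both phases; advice and `A`'s coin count read off the coin budget `cl`).
[cite: HastadImpagliazzoLevinLuby1999, Lemma 6.3.2 (proof: the oracle TM M^{(A)})] -/
noncomputable def mach (cl : ℕ → ℕ) : RandAlg (List Bool) Bool where
  run inp R := decide (0 < (coreM f A NsP τnP kcP mlenF Kb (boolPair inp R)).length)
  coinLen := cl

/-- The machine's run as a total string function. [folklore] -/
noncomputable def machFn : List Bool → List Bool := fun q => encodeBool (decide (0 < (coreM f A NsP τnP kcP mlenF Kb q).length))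

variable {P f A NsP τnP kcP mlenF Kb}

/-- `machFn` is the pipeline `ltLenF ∘ ⟨ε, coreM⟩`. [folklore] -/
theorem machFn_eq : machFn f A NsP τnP kcP mlenF Kb = ltLenF ∘ fanoutFn (fun _ => []) (coreM f A NsP τnP kcP mlenF Kb) := by
  funext q
  rw [Function.comp_apply, fanoutFn_apply, ltLenF_boolPair, machFn]
  rfl

/-- Value of one round on a pair whose stage does not lengthen. [folklore] -/
theorem rndF_boolPair (u : List Bool) {v : List Bool} (h : (stgF f A NsP τnP kcP mlenF v).length ≤ v.length) :
    rndF f A NsP τnP kcP mlenF (boolPair u v) = boolPair u (stgF f A NsP τnP kcP mlenF v) := by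
  rw [rndF, PRGStretch.clampAdd_eq_of_le (by rw [mapSndFn_boolPair, length_boolPair, length_boolPair]; omega), mapSndFn_boolPair]

/-- The machine's templates are well formed (enough coins). [folklore] -/
theorem tmplM_wf {N : ℕ} (hτn : 1 ≤ τnP.eval N) (t : ℕ) {R : List Bool} :
    ∀ {j : ℕ}, j * (P.QM f A NsP τnP N t).cS ≤ R.length → ∀ q ∈ P.tmplM f A NsP τnP N t R j, q.1.length = N
  | 0, _ => by simp [tmplM]
  | j + 1, hR => by
    intro q hq
    rw [tmplM, Greedy.Data.stage] at hq
    rcases List.mem_append.1 hq with hq | hq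
    · exact tmplM_wf hτn t ((Nat.mul_le_mul_right _ j.le_succ).trans hR) q hq
    · rw [List.mem_singleton.1 hq, Greedy.Data.choice]
      have hlen : (P.QM f A NsP τnP N t).cS ≤ (R.drop (j * (P.QM f A NsP τnP N t).cS)).length := by
        rw [List.length_drop]; rw [Nat.succ_mul] at hR; omega
      have h1 : bLen N + (Greedy.Data.argmaxFirst ((P.QM f A NsP τnP N t).estv (P.tmplM f A NsP τnP N t R j)
          (R.drop (j * (P.QM f A NsP τnP N t).cS))) (τnP.eval N) + 1) * (N + P.cE A NsP N t) ≤ (P.QM f A NsP τnP N t).cS := by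
        simp only [Greedy.Data.cS, QM]
        exact Nat.add_le_add_left (Nat.mul_le_mul_right _ (Greedy.Data.argmaxFirst_lt _ hτn)) _
      exact (length_blockOf (P := P) (f := f) (A := A) (NsP := NsP) (τnP := τnP) (h1.trans hlen)).2.1

/-- **Phase 1 computes the machine's templates**: `j` rounds from `⟨1^j, ⟨hdr, ⟨ε, R⟩⟩⟩`. [cite: HastadImpagliazzoLevinLuby1999, Lemma 6.3.2 (proof, Phase 1)] -/
theorem iterate_rndF (hS : ProgSpec P kcP mlenF) (hlp : IsLengthPreserving f) {N t : ℕ} (hk : 1 ≤ P.kc N) (hτn : 1 ≤ τnP.eval N)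
    (h2N : 2 * N + 2 ≤ (P.QM f A NsP τnP N t).cS) (u : List Bool) {R : List Bool} :
    ∀ {i : ℕ}, i * (P.QM f A NsP τnP N t).cS ≤ R.length →
      (rndF f A NsP τnP kcP mlenF)^[i] (boolPair u (wrec N t (P.κA A N t) [] R)) =
        boolPair u (wrec N t (P.κA A N t) (P.tmplM f A NsP τnP N t R i) (R.drop (i * (P.QM f A NsP τnP N t).cS)))
  | 0, _ => by simp [tmplM]
  | i + 1, hR => by
    have hR' : i * (P.QM f A NsP τnP N t).cS ≤ R.length := (Nat.mul_le_mul_right _ i.le_succ).trans hR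
    have hRi : (P.QM f A NsP τnP N t).cS ≤ (R.drop (i * (P.QM f A NsP τnP N t).cS)).length := by
      rw [List.length_drop, Nat.succ_mul] at *; omega
    have hwf := tmplM_wf (P := P) (f := f) (A := A) hτn t hR'
    rw [Function.iterate_succ_apply', iterate_rndF hS hlp hk hτn h2N u hR', rndF_boolPair u (length_stgF_le hS hlp hk hτn hwf hRi h2N),
      stgF_apply hS hlp hk hτn hwf hRi, tmplM, List.drop_drop, Nat.succ_mul]

/-- **`Phase 1` as a program value.** [folklore] -/
theorem ph1F_apply (hS : ProgSpec P kcP mlenF) (hlp : IsLengthPreserving f) {N t : ℕ} (hk : 1 ≤ P.kc N) (hτn : 1 ≤ τnP.eval N)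
    (h2N : 2 * N + 2 ≤ (P.QM f A NsP τnP N t).cS) {j : ℕ} {R : List Bool} (hR : j * (P.QM f A NsP τnP N t).cS ≤ R.length) :
    ph1F f A NsP τnP kcP mlenF (boolPair (ones j) (wrec N t (P.κA A N t) [] R)) =
      boolPair (ones j) (wrec N t (P.κA A N t) (P.tmplM f A NsP τnP N t R j) (R.drop (j * (P.QM f A NsP τnP N t).cS))) := by
  rw [ph1F]
  simp only [boolUnpair_boolPair, eval_X, ones, List.length_replicate]
  exact iterate_rndF hS hlp hk hτn h2N _ hR

/-- `ph1F ∈ FP`. [cite: AroraBarakCC2009, §1.4.1] -/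
theorem ph1F_mem_FP (hS : ProgSpec P kcP mlenF) (hf : f ∈ FP) (hA : IsPPT A encodeBool) : ph1F f A NsP τnP kcP mlenF ∈ FP :=
  iterate_mem_FP (PRGStretch.clampAdd_mem_FP 0 (mapSndFn_mem_FP (stgF_mem_FP (NsP := NsP) (τnP := τnP) hS hf hA).1)) 0
    (PRGStretch.length_clampAdd_le 0 _) X

/-- **The coin code** `((κ + 1)(k + 1) + j)·Kb + t` of advice `t < Kb`, index `j ≤ k` and coin count `κ`. [folklore] -/
def code (Kb kk t j κ : ℕ) : ℕ := ((κ + 1) * (kk + 1) + j) * Kb + t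

/-- Decoding the coin code. [folklore] -/
theorem code_decode {Kb kk t j κ : ℕ} (ht : t < Kb) (hj : j ≤ kk) :
    code Kb kk t j κ % Kb = t ∧ code Kb kk t j κ / Kb = (κ + 1) * (kk + 1) + j ∧
      ((κ + 1) * (kk + 1) + j) % (kk + 1) = j ∧ ((κ + 1) * (kk + 1) + j) / (kk + 1) = κ + 1 := by
  have hKb : 0 < Kb := by omega
  refine ⟨by rw [code, Nat.add_comm, Nat.add_mul_mod_self_right, Nat.mod_eq_of_lt ht],
    by rw [code, Nat.add_comm, Nat.add_mul_div_right _ _ hKb, Nat.div_eq_of_lt ht, zero_add],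
    by rw [Nat.add_comm, Nat.add_mul_mod_self_right, Nat.mod_eq_of_lt (Nat.lt_succ_of_le hj)],
    by rw [Nat.add_comm, Nat.add_mul_div_right _ _ (Nat.succ_pos _), Nat.div_eq_of_lt (Nat.lt_succ_of_le hj), zero_add]⟩

set_option maxHeartbeats 1600000 in
/-- **Values of the decoding and set-up** on `⟨⟨1^N, z⟩, R⟩`, `|R| = code`. [folklore] -/
theorem tunits (hS : ProgSpec P kcP mlenF) {N t j κ : ℕ} (ht : t < Kb.eval N) (hj : j ≤ P.kk N) (zz : List Bool) {R : List Bool}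
    (hR : R.length = code (Kb.eval N) (P.kk N) t j κ) :
    let q := boolPair (boolPair (unaryEncodeNat N) zz) R
    tN q = unaryEncodeNat N ∧ tZ q = zz ∧ tT Kb q = ones t ∧ tJ kcP Kb q = ones j ∧ tK kcP Kb q = ones κ ∧
      tCtx Kb q = boolPair (unaryEncodeNat N) (unaryEncodeNat t) ∧ tHdr kcP Kb q = hdr N t κ ∧
      tS0 kcP Kb q = boolPair (ones j) (wrec N t κ [] R) := by
  intro q
  have hN := length_unary' N
  obtain ⟨hmod, hdiv, hmod2, hdiv2⟩ := code_decode (κ := κ) ht hj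
  have h1 : tN q = unaryEncodeNat N := by simp [q, tN]
  have h2 : tZ q = zz := by simp [q, tZ]
  have hdm1 : tDm1 Kb q = boolPair (ones ((κ + 1) * (P.kk N + 1) + j)) (ones t) := by
    rw [tDm1, Function.comp_apply, fanoutFn_apply, Function.comp_apply, h1, polyFn_apply, hN, Function.comp_apply]
    simp only [q, sndF_boolPair, onesFn, unary_eq_ones, hR]
    rw [divModFn_boolPair, hdiv, hmod]
  have h3 : tT Kb q = ones t := by rw [tT, Function.comp_apply, hdm1, sndF_boolPair]
  have hB2 : tB2 kcP q = ones (P.kk N + 1) := by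
    rw [tB2, Function.comp_apply, Function.comp_apply, h1, polyFn_apply, hN, ← hS.kk_eq]; simp [ones, List.replicate_succ]
  have hdm2 : tDm2 kcP Kb q = boolPair (ones (κ + 1)) (ones j) := by
    rw [tDm2, Function.comp_apply, fanoutFn_apply, hB2, Function.comp_apply, hdm1, fstF_boolPair, divModFn_boolPair, hdiv2, hmod2]
  have h4 : tJ kcP Kb q = ones j := by rw [tJ, Function.comp_apply, hdm2, sndF_boolPair]
  have h5 : tK kcP Kb q = ones κ := by
    rw [tK, Function.comp_apply, fanoutFn_apply, Function.comp_apply, hdm2, fstF_boolPair, dropFn_boolPair]; simp [ones]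
  have h6 : tCtx Kb q = boolPair (unaryEncodeNat N) (unaryEncodeNat t) := by rw [tCtx, fanoutFn_apply, h1, h3, unary_eq_ones t]
  have h7 : tHdr kcP Kb q = hdr N t κ := by rw [tHdr, fanoutFn_apply, h6, h5, hdr]
  have h8 : tS0 kcP Kb q = boolPair (ones j) (wrec N t κ [] R) := by
    rw [tS0, fanoutFn_apply, fanoutFn_apply, fanoutFn_apply, h4, h7, wrec]; simp [q, encT]
  exact ⟨h1, h2, h3, h4, h5, h6, h7, h8⟩

set_option maxHeartbeats 4000000 in
/-- **The machine computes the printed rule** on a genuine input `⟨1^N, z⟩` with the coin budget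
`code (Kb N) k t j κ_A`: Phase 1 for `j` stages, then Phase 2. [cite: HastadImpagliazzoLevinLuby1999, Lemma 6.3.2 (proof: M^{(A)}, Phases 1–2)] -/
theorem mach_run (hS : ProgSpec P kcP mlenF) (hlp : IsLengthPreserving f) {N t j : ℕ} (hk : 1 ≤ P.kc N) (hτn : 1 ≤ τnP.eval N)
    (h2N : 2 * N + 2 ≤ (P.QM f A NsP τnP N t).cS) (ht : t < Kb.eval N) (hj : j ≤ P.kk N)
    {zz : List Bool} (hz : zz.length = La N) {R : List Bool} (hR : R.length = code (Kb.eval N) (P.kk N) t j (P.κA A N t))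
    (hRj : j * (P.QM f A NsP τnP N t).cS + P.cSamp A N t + 1 ≤ R.length) (cl : ℕ → ℕ) :
    (mach f A NsP τnP kcP mlenF Kb cl).run (boolPair (unaryEncodeNat N) zz) R = P.outM f A NsP τnP N t j zz R := by
  obtain ⟨-, h2, -, -, -, h6, -, h8⟩ := tunits (P := P) hS ht hj zz hR
  set q := boolPair (boolPair (unaryEncodeNat N) zz) R with hq
  set Q := P.QM f A NsP τnP N t with hQ
  set τj := P.tmplM f A NsP τnP N t R j with hτj
  set Rr := R.drop (j * Q.cS) with hRr
  have hjR : j * Q.cS ≤ R.length := by omega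
  have hwf : ∀ q ∈ τj, q.1.length = N := tmplM_wf (P := P) (f := f) (A := A) hτn t hjR
  have hV1 : tV1 f A NsP τnP kcP mlenF Kb q = wrec N t (P.κA A N t) τj Rr := by
    rw [tV1, Function.comp_apply, Function.comp_apply, h8, ph1F_apply hS hlp hk hτn h2N hjR, sndF_boolPair]
  obtain ⟨-, -, -, h4', h5', -, -, -, h12', h13', h14', -⟩ := eunits (A := A) (NsP := NsP) hS N t τj Rr
  have hRrlen : P.cSamp A N t + 1 ≤ Rr.length := by rw [hRr, List.length_drop]; omega
  obtain ⟨hdc, hkd, hkc⟩ := dTot_le_cSamp (P := P) (A := A) N t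
  have hY : tY f A NsP τnP kcP mlenF Kb q = yrec N t τj true zz := by
    rw [tY, fanoutFn_apply, fanoutFn_apply, fanoutFn_apply, h6, Function.comp_apply, hV1, h4', h2, yrec]
  have hRrq : tRr f A NsP τnP kcP mlenF Kb q = Rr := by rw [tRr, Function.comp_apply, hV1, h5']
  have hRD : tRD f A NsP τnP kcP mlenF Kb q = Rr.take (P.dTot A N t) := by
    rw [tRD, Function.comp_apply, fanoutFn_apply, Function.comp_apply, hV1, h12', hRrq, takeFn_boolPair]; simp [ones]
  have hRE : tRE f A NsP τnP kcP mlenF Kb q = (Rr.drop (P.dTot A N t)).take (P.eTot A N t) := by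
    rw [tRE, Function.comp_apply, fanoutFn_apply, Function.comp_apply, hV1, h13', Function.comp_apply, fanoutFn_apply, Function.comp_apply,
      hV1, h12', hRrq, dropFn_boolPair, takeFn_boolPair]; simp [ones]
  have hBeta : tBeta f A NsP τnP kcP mlenF Kb q = (Rr.drop (P.cSamp A N t)).take 1 := by
    rw [tBeta, Function.comp_apply, fanoutFn_apply, Function.comp_apply, fanoutFn_apply, Function.comp_apply, hV1, h14', hRrq, dropFn_boolPair,
      takeFn_boolPair]; simp [ones]
  have hzz : true = true → zz.length = La N := fun _ => hz
  have hAD : tAD f A NsP τnP kcP mlenF Kb q = encodeBool (P.runD f A N t τj true zz (Rr.take (P.dTot A N t))) := by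
    rw [tAD, Function.comp_apply, fanoutFn_apply, hY, hRD]
    exact runDF_apply hS hlp hk hwf true hzz (by rw [List.length_take]; omega)
  have hAE : tAE f A NsP τnP kcP mlenF Kb q = encodeBool (P.runE f A N t τj true zz ((Rr.drop (P.dTot A N t)).take (P.eTot A N t))) := by
    rw [tAE, Function.comp_apply, fanoutFn_apply, hY, hRE]
    have hce : P.cSamp A N t = P.dTot A N t + P.eTot A N t := rfl
    exact runEF_apply hS hlp hk hwf true hzz (by rw [List.length_take, List.length_drop]; omega)
  obtain ⟨b, hb⟩ : ∃ b : Bool, (Rr.drop (P.cSamp A N t)).take 1 = [b] := by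
    have hne : Rr.drop (P.cSamp A N t) ≠ [] := by rw [ne_eq, ← List.length_eq_zero_iff, List.length_drop]; omega
    obtain ⟨b, l, hl⟩ := List.exists_cons_of_ne_nil hne
    exact ⟨b, by rw [hl]; rfl⟩
  have eβ : P.outM f A NsP τnP N t j zz R = (if P.runD f A N t τj true zz (Rr.take (P.dTot A N t)) =
      P.runE f A N t τj true zz ((Rr.drop (P.dTot A N t)).take (P.eTot A N t)) then b else P.runD f A N t τj true zz (Rr.take (P.dTot A N t))) := by
    have e1 : P.outM f A NsP τnP N t j zz R = (if P.runD f A N t τj true zz (Rr.take (P.dTot A N t)) =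
        P.runE f A N t τj true zz ((Rr.drop (P.dTot A N t)).take (P.eTot A N t)) then
          decide ((Rr.drop (P.dTot A N t + P.eTot A N t)).take 1 = [true]) else P.runD f A N t τj true zz (Rr.take (P.dTot A N t))) := rfl
    rw [e1, show P.dTot A N t + P.eTot A N t = P.cSamp A N t from rfl, hb]
    cases b <;> simp
  have hout : outF f A NsP τnP kcP mlenF Kb q = [P.outM f A NsP τnP N t j zz R] := by
    rw [outF, iteFn_apply hAD, iteFn_apply hAE, iteFn_apply hAE, hBeta, hb, eβ]
    cases P.runD f A N t τj true zz (Rr.take (P.dTot A N t)) <;>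
      cases P.runE f A N t τj true zz ((Rr.drop (P.dTot A N t)).take (P.eTot A N t)) <;> rfl
  show decide (0 < (coreM f A NsP τnP kcP mlenF Kb q).length) = _
  rw [coreM, unaryBit_apply hout]
  cases P.outM f A NsP τnP N t j zz R <;> simp [ones]

set_option maxHeartbeats 4000000 in
/-- **The machine is PPT** for a PPT `A`, `f ∈ FP` and a polynomially bounded coin budget.
[cite: HastadImpagliazzoLevinLuby1999, Lemma 6.3.2 ("The running time of M^{(A)} is polynomial in the running time of A, 1/δ_A(n), and n")] -/
theorem isPPT_mach (hS : ProgSpec P kcP mlenF) (hf : f ∈ FP) (hA : IsPPT A encodeBool) {cl : ℕ → ℕ}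
    (hcl : ∃ p : Polynomial ℕ, ∀ ℓ, cl ℓ ≤ p.eval ℓ) : IsPPT (mach f A NsP τnP kcP mlenF Kb cl) encodeBool := by
  obtain ⟨hrD, hrE⟩ := runs_mem_FP (A := A) hS hf hA
  obtain ⟨-, -, -, hdT, heT, hcS, -⟩ := cnts_mem_FP (NsP := NsP) hS hf hA
  have hph1 := ph1F_mem_FP (NsP := NsP) (τnP := τnP) hS hf hA
  have hTm : eTm ∈ FP := comp_mem_FP fstF_mem_FP sndF_mem_FP
  have hCs : eCs ∈ FP := comp_mem_FP sndF_mem_FP sndF_mem_FP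
  have h1 : tN ∈ FP := comp_mem_FP fstF_mem_FP fstF_mem_FP
  have h2 : tZ ∈ FP := comp_mem_FP sndF_mem_FP fstF_mem_FP
  have hdm1 : tDm1 Kb ∈ FP :=
    comp_mem_FP divModFn_mem_FP (fanoutFn_mem_FP (comp_mem_FP (polyFn_mem_FP _) h1) (comp_mem_FP onesFn_mem_FP sndF_mem_FP))
  have h3 : tT Kb ∈ FP := comp_mem_FP sndF_mem_FP hdm1
  have hB2 : tB2 kcP ∈ FP := comp_mem_FP (cons_mem_FP true) (comp_mem_FP (polyFn_mem_FP _) h1)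
  have hdm2 : tDm2 kcP Kb ∈ FP := comp_mem_FP divModFn_mem_FP (fanoutFn_mem_FP hB2 (comp_mem_FP fstF_mem_FP hdm1))
  have h4 : tJ kcP Kb ∈ FP := comp_mem_FP sndF_mem_FP hdm2
  have h5 : tK kcP Kb ∈ FP := comp_mem_FP dropFn_mem_FP (fanoutFn_mem_FP (const_mem_FP _) (comp_mem_FP fstF_mem_FP hdm2))
  have h6 : tCtx Kb ∈ FP := fanoutFn_mem_FP h1 h3
  have h7 : tHdr kcP Kb ∈ FP := fanoutFn_mem_FP h6 h5
  have h8 : tS0 kcP Kb ∈ FP := fanoutFn_mem_FP h4 (fanoutFn_mem_FP h7 (fanoutFn_mem_FP (const_mem_FP _) sndF_mem_FP))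
  have hV1 : tV1 f A NsP τnP kcP mlenF Kb ∈ FP := comp_mem_FP sndF_mem_FP (comp_mem_FP hph1 h8)
  have hY : tY f A NsP τnP kcP mlenF Kb ∈ FP :=
    fanoutFn_mem_FP h6 (fanoutFn_mem_FP (comp_mem_FP hTm hV1) (fanoutFn_mem_FP (const_mem_FP _) h2))
  have hRr : tRr f A NsP τnP kcP mlenF Kb ∈ FP := comp_mem_FP hCs hV1
  have hRD : tRD f A NsP τnP kcP mlenF Kb ∈ FP := comp_mem_FP takeFn_mem_FP (fanoutFn_mem_FP (comp_mem_FP hdT hV1) hRr)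
  have hRE : tRE f A NsP τnP kcP mlenF Kb ∈ FP := comp_mem_FP takeFn_mem_FP (fanoutFn_mem_FP (comp_mem_FP heT hV1)
    (comp_mem_FP dropFn_mem_FP (fanoutFn_mem_FP (comp_mem_FP hdT hV1) hRr)))
  have hBeta : tBeta f A NsP τnP kcP mlenF Kb ∈ FP := comp_mem_FP takeFn_mem_FP (fanoutFn_mem_FP (const_mem_FP _)
    (comp_mem_FP dropFn_mem_FP (fanoutFn_mem_FP (comp_mem_FP hcS hV1) hRr)))
  have hAD : tAD f A NsP τnP kcP mlenF Kb ∈ FP := comp_mem_FP hrD (fanoutFn_mem_FP hY hRD)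
  have hAE : tAE f A NsP τnP kcP mlenF Kb ∈ FP := comp_mem_FP hrE (fanoutFn_mem_FP hY hRE)
  have hout : outF f A NsP τnP kcP mlenF Kb ∈ FP := iteFn_mem_FP hAD (iteFn_mem_FP hAE hBeta (const_mem_FP _))
    (iteFn_mem_FP hAE (const_mem_FP _) hBeta)
  have hcore : coreM f A NsP τnP kcP mlenF Kb ∈ FP := unaryBit_mem_FP hout
  have hFn : machFn f A NsP τnP kcP mlenF Kb ∈ FP := by
    rw [machFn_eq]; exact comp_mem_FP ltLenF_mem_FP (fanoutFn_mem_FP (const_mem_FP _) hcore)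
  refine ⟨?_, hcl⟩
  exact PolyTimeComputable.of_encode_eq (f := machFn f A NsP τnP kcP mlenF Kb) (fun p : List Bool × List Bool => boolPair p.1 p.2)
    (fun _ => rfl) (fun _ => rfl) hFn

end Program

end Params

end GH

end HILL

end Literature.Computability.Cryptography
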